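import Literature.NumberTheory.LFunctions.AlternativeHypothesisFormFactorProofs
import Literature.NumberTheory.LFunctions.AlternativeHypothesisFormFactorRHProofs
import Literature.NumberTheory.LFunctions.MontgomeryTheoremGoldstonMontgomery
import Literature.NumberTheory.LFunctions.MontgomeryTheoremWindowIntegrals
import HarnessLib

/-!
# BGSTB 2025, Lemma 6: the sound clauses (i), (ii) and (iv) proved; erratum E-ah-5 (the printed
# evaluation of `∫ G_λ` behind (iii)/(v)) certified and corrected; a sound two-sided (iii)

Topic `Literature/NumberTheory/LFunctions` (namespace `Literature.NumberTheory.LFunctions`; helpers in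
the sub-namespace `AH`). PROOF LAYER for the claim `bgstb2025_lemma6` of
`AlternativeHypothesisFormFactor.lean` (cell `rh-crit/ah`, C5, seat t5); theorems only, no
definitions, no named facts; the audited statement file is untouched. LABEL: **NOT RH-BEARING** —
RH and the claim `bgstb2025_lemma5_rh` / `bgstb2025_corollary5` enter only as antecedents /
hypotheses (consumed, never asserted); §4 is pure real analysis (no zeta zeros). Nothing here bears
on the truth of RH or of AH.

## What the source prints (held TeX text `paper:arxiv-2508.10857`, chunks p0014–p0015)

S. A. C. Baluyot, D. A. Goldston, A. I. Suriajaya, C. L. Turnage-Butterbaugh, *The Alternative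
Hypothesis for Zeros of the Riemann Zeta-Function*, arXiv:2508.10857 (2025; UNREFEREED, D-0012):

* **Lemma 6** (p0014): "Assume the Riemann Hypothesis and AH-Pairs. Then for `L ∈ ℤ` and
  `0 < λ ≤ 1/4` we have (i) `∫_{2L−λ}^{2L+λ} F(β) dβ = 1 + O(λ²) + O(λ E_G(λ, L)) + O(1/(λ √log T))`.
  … Let `K = 2L + 1` be an odd integer. Then for `0 < λ ≤ 1/4` we have
  (iii) `∫_{K−λ}^{K+λ} F(β) dβ = 2(P_0 − 1) + O(λ) + O(E_G(λ², K)) + O(1/(λ⁴ √log T))`.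
  If `K = ±1`, then in addition to (iii) we have for `0 < λ ≤ 1/4`
  (iv) `∫_{1−λ}^{1+λ} F(β) dβ = ∫_1^{1+λ} F(β) dβ + O(λ)`, and
  `∫_{−1−λ}^{−1+λ} F(β) dβ = ∫_{−1−λ}^{−1} F(β) dβ + O(λ)`. …"
* **§6, (Hthm4)/(F-Hthm4)** (p0014:L40–L52): "`H_λ(α) := λ² G_λ(α) = ∫ k_λ(β) F(α + β) dβ`. For
  `0 < h ≤ λ/2`, we have `(H_λ(α) − H_{λ−h}(α))/h ≤ ∫_{−λ}^{λ} F(α + β) dβ ≤ (H_{λ+h}(α) − H_λ(α))/h`,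
  which follows immediately from `(1/h)(k_λ(β) − k_{λ−h}(β)) ≤ 1_{[−λ,λ]}(β) ≤ (1/h)(k_{λ+h}(β) − k_λ(β))`."
* **§6, proof of (i)** (p0014:L54–L72): "`H_λ(2L) = H_λ(0) + O(λ² E_G(λ, L)) = … = λ + O(λ³)
  + O(1/√log T) + O(λ² E_G(λ, L))` … Taking `λ/4 ≤ h ≤ λ/2`, we have
  `(H_{λ±h}(2L) − H_λ(2L))/(±h) = 1 + O(λ²) + O(λ E_G(λ, L)) + O(1/(λ √log T))`. Hence by (F-Hthm4) …"
* **§6, proof of (ii)** (p0014:L69–L100): "Take a fixed `α ∈ ℝ ∖ ℤ`, and choose `λ` so that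
  `0 < λ ≤ ½‖α‖` … let `α* := α − 2L`, so that `−1 + 2λ ≤ α* ≤ −2λ` if `[α]` is odd and
  `2λ ≤ α* ≤ 1 − 2λ` if `[α]` is even. Then Lemma 5 (iv) and (ii) implies
  `G_λ(α) = G_λ(α*) + O(E_G(λ, L)) = |α*| + O(1/√log T) + O(1/(λ² log T)) + O(E_G(λ, L))` …
  We complete the proof by choosing `h = λ²` and degrade slightly the two middle error terms".
* **§6, proof of (iv)** (p0015:L21–L23): "By MT we have `F(w) ≪ 1` for `1 − λ ≤ w ≤ 1` and therefore
  `∫_{1−λ}^{1+λ} F(w) dw = ∫_1^{1+λ} F(w) dw + O(λ)`, which proves (iv) when `K = 1`."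
* **§6, proof of (iii)–(v), the evaluation of `∫ G_λ`** (p0015:L9–L15 = TeX l.1013–1018):
  "`∫_{1−λ}^{1+λ} G_λ(α) dα = ∫_{1−λ}^{1+λ} (1/λ²) ∫_{−λ}^{λ} (λ − |β|) F(α + β) dβ dα
  = (1/λ²) ∫_{1−λ}^{1+λ} ∫_{α−λ}^{α+λ} (λ − |w − α|) F(w) dw dα
  = (1/λ²) ∫_{1−2λ}^{1+2λ} F(w) (∫_{w−λ}^{w+λ} (λ − |w − α|) dα) dw = ∫_{1−2λ}^{1+2λ} F(w) dw`".

## What is proved here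

* §1 `AH.sq_mul_heathBrownG`, `AH.integral_window_add_le`, `AH.integral_window_sub_le` — (Hthm4) and
  the two halves of (F-Hthm4) for `F = montgomeryFormFactor ≥ 0` (`T > 1`).
* §2 `bgstb2025_lemma6_iv` — Lemma 6 (iv) (both clauses, = conjuncts 3–4 of `bgstb2025_lemma6`
  verbatim) from RH alone, via the tree's `AH.exists_abs_formFactor_le_near_one` (`F ≪ 1` on
  `1/2 ≤ |α| ≤ 1`, from MT) and `F ≥ 0`.
* §3 `bgstb2025_lemma6_i_of_lemma5_rh` — Lemma 6 (i) (= conjunct 1 of `bgstb2025_lemma6`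
  verbatim, same quantifier block) from the claim `bgstb2025_lemma5_rh` (Lemma 5 (i) at
  `α = 0`, consumed as a hypothesis) and the tree's proved `bgstb2025_lemma5_ah_of_RH` (Lemma 5 (iv)
  at `α = 0`), following the printed proof: `H_μ(2L)` at `μ ∈ {λ/2, λ, 3λ/2}` and the differencing
  at `h = λ/2`; **`bgstb2025_lemma6_i`** — the same OUTRIGHT from RH, fed with the tree's discharge
  `bgstb2025_lemma5_rh_holds` (`AlternativeHypothesisFormFactorRHProofs`).
* §4 **ERRATUM E-ah-5** (cell `rh-crit/ah`, of record 2026-08-26): the third equality of the last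
  quoted display is false as an identity — after the interchange `α` ranges over
  `[1−λ, 1+λ] ∩ [w−λ, w+λ]`, not over `[w−λ, w+λ]`. Kernel certificate, independent of ζ:
  `AH.bgstb2025_lemma6_printed_display_fails` (`F ≡ 1`, `λ = 1/4`: `1/2 ≠ 1`);
  the TRUE identity `AH.integral_integral_tent_eq` / `AH.sq_mul_integral_heathBrownG`:
  `λ² ∫_{c−λ}^{c+λ} G_λ = ∫_{−2λ}^{2λ} Φ_λ(u) F(c + u) du`, `Φ_λ(u) = λ² − u²/2 (|u| ≤ λ)`,
  `(2λ − |u|)²/2 (λ ≤ |u| ≤ 2λ)` (`AH.integral_tentWindow`), of mass `2λ³`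
  (`AH.integral_tentWindow_weight`; the printed flat window has mass `4λ·λ²`), with
  `0 ≤ Φ_λ ≤ λ²`, `Φ_λ ≥ λ²/2` on `|u| ≤ λ` (`AH.tentWindow_bounds`); hence for `F ≥ 0` the printed
  display survives as the inequality `∫_{c−λ}^{c+λ} G_λ ≤ ∫_{c−2λ}^{c+2λ} F`
  (`AH.integral_heathBrownG_le_window`) and `½ ∫_{c−λ}^{c+λ} F ≤ ∫_{c−λ}^{c+λ} G_λ`
  (`AH.half_integral_window_le_integral_heathBrownG`).
* §5 `bgstb2025_lemma6_iii_lower_of_corollary5` — what the paper's inputs do give towards (iii) at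
  `K = 1`: the LOWER bound `∫_{1−λ}^{1+λ} F ≥ 2(P_0 − 1) − C(λ + E_G(λ/2, 1) + 1/(λ² √log T))`
  (`0 < λ ≤ 1/2`), from the claim `bgstb2025_corollary5` at `λ/2` and §4; **`bgstb2025_lemma6_iii_lower`**
  — the same outright from RH via the tree's `bgstb2025_corollary5_holds`.

* §6 (v2) **the sound two-sided form of (iii) for EVERY odd `K`** (OUR REPLACEMENT of the printed
  route; tent sandwich + Corollary 5 + Lemma 5 (iv), all proved in the tree):
  `bgstb2025_lemma6_iii_lower_odd` — `2(P_0 − 1) − C(λ + E_G(λ/2, K) + 1/(λ² √log T)) ≤ ∫_{K−λ}^{K+λ} F`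
  (`0 < λ ≤ 1/2`); `bgstb2025_lemma6_iii_upper_odd` —
  `∫_{K−λ}^{K+λ} F ≤ (1 + λ²/μ²)(2(P_0 − 1) + C(μ + E_G(μ, K) + 1/(μ² √log T)))` (`0 < λ ≤ μ ≤ 1/4`);
  tools `AH.sq_sub_mul_integral_window_le` (tent majorant `(μ² − λ²/2) ∫_{c−λ}^{c+λ} F ≤ μ² ∫_{c−μ}^{c+μ} G_μ`)
  and `AH.exists_abs_integral_heathBrownG_odd_sub_le` (transport `1 ↦ K`, cost `C μ E_G(μ, K)`).
  No `η = λ²` step, so no `λ⁻⁴`/`E_G(λ², K)`; `μ = λ^{2/3}` gives (iii) in two-sided `o(1)`-form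
  with rate `λ^{2/3}` (the printed `O(λ)` is not recovered).

* §7 (v3) `bgstb2025_lemma6_ii` — Lemma 6 (ii) (the windows at non-integers; not typed in the
  claim) PROVED from RH by the printed route (Lemma 5 (ii) + (iv), differencing at `h = λ²`):
  `|(1/2λ) ∫_{α−λ}^{α+λ} F − s(α)| ≤ C(λ + 1/(λ⁵ √log T) + E_G(λ, L)/λ)` for `0 < λ ≤ 1/4`,
  `2λ ≤ |α − 2L| ≤ 1 − 2λ` (`s = triangleWave`).

* §8 (v4) the ONE-SIDED windows at `±1` (what the print derives at p0015:L26 from (K=1iii) and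
  (iv)): `bgstb2025_lemma6_right_of_one_lower` / `_upper` for `∫_1^{1+λ} F` (sound two-sided
  replacement), and `integral_formFactor_left_of_neg_one_eq` (`∫_{−1−λ}^{−1} F = ∫_1^{1+λ} F`).

* §9 (v4) `bgstb2025_lemma6_ii_uniform` — (ii) with the `L`-bookkeeping discharged: for every `α`
  at distance `≥ 2λ` from `ℤ`, the bound with `E_G(λ, |α| + 1)` (`2L = 2·round(α/2)`).

CONSEQUENCE FOR THE TYPED CLAIM. `bgstb2025_lemma6` (conjuncts (i), (iii), (iv)-left, (iv)-right)
is NOT discharged: its conjunct (iii), with the printed exponents `λ⁻⁴`, `E_G(λ², K)` and the rate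
`O(λ)`, rests on the invalid display (then propagated through (v), `η = λ²`). The statement (iii)
may still be true; no `¬`-certificate is claimed or sought (E-ah-5 of record: "unsupported as
printed", not refuted). The sound clauses, and a sound two-sided replacement of (iii) (§6), are
supplied here as stand-alone theorems with the typed binders.

## Proof route and deviations

(i), (iv): as printed (quotes above); the only inputs are Lemma 5 (i) [hypothesis
`bgstb2025_lemma5_rh`], Lemma 5 (iv) [tree theorem `bgstb2025_lemma5_ah_of_RH`], `F ≥ 0`
[tree theorem `Montgomery.montgomeryFormFactor_nonneg`], `F ≪ 1` near `±1`
[tree theorem `AH.exists_abs_formFactor_le_near_one`], continuity of `F`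
[`RudnickSarnak.continuous_montgomeryFormFactor`]. Deviation: the printed "`λ/4 ≤ h ≤ λ/2`" is
taken as `h = λ/2` (radii `λ/2, λ, 3λ/2 ≤ 3/8 ≤ 1/2`, inside Lemma 5's range), and
`E_G(μ, 2|L|) ≤ 4 E_G(λ, L)` for `μ ≥ λ/2` replaces "combined and slightly degraded". §4: the
substitutions `α = c + s`, `β = u − s`, Fubini on the box `(−λ, λ] × (−2λ, 2λ]` (continuous
integrand), and the elementary evaluation of `∫_{−λ}^{λ} (λ − |u − s|)₊ ds`.

## References

* [BaluyotGoldstonSuriajayaTurnageButterbaugh2025] arXiv:2508.10857, Lemma 6 (p. 14) and §6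
  (pp. 14–15).
-/

noncomputable section

open Filter Set MeasureTheory Asymptotics
open scoped Real Topology

namespace Literature.NumberTheory.LFunctions

namespace AH

/-! ## §1. The differencing inequalities (F-Hthm4) -/

/-- `λ² G_λ(α) = ∫_{−λ}^{λ} (λ − |β|) F(α + β) dβ = H_λ(α)` (BGSTB 2025, (Hthm4)), for `λ ≠ 0`.
[cite: BaluyotGoldstonSuriajayaTurnageButterbaugh2025, §6 (Hthm4)] -/
theorem sq_mul_heathBrownG {lam : ℝ} (hlam : lam ≠ 0) (α T : ℝ) :
    lam ^ 2 * heathBrownG lam α T =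
      ∫ β in (-lam)..lam, (lam - |β|) * montgomeryFormFactor (α + β) T := by
  unfold heathBrownG
  have : lam ^ 2 ≠ 0 := pow_ne_zero 2 hlam
  field_simp

/-- **(F-Hthm4), upper half**: for `T > 1` (so `F ≥ 0`), `0 < h` and `0 < λ`,
`h ∫_{−λ}^{λ} F(α+β) dβ + H_λ(α) ≤ H_{λ+h}(α)`, since `k_{λ+h} − k_λ ≥ h` on `[−λ, λ]` and
`k_{λ+h} ≥ 0`. [cite: BaluyotGoldstonSuriajayaTurnageButterbaugh2025, §6 (F-Hthm4)] -/
theorem integral_window_add_le {T : ℝ} (hT : 1 < T) {lam h : ℝ} (hlam : 0 < lam) (hh : 0 < h)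
    (α : ℝ) :
    h * (∫ β in (-lam)..lam, montgomeryFormFactor (α + β) T) +
        (∫ β in (-lam)..lam, (lam - |β|) * montgomeryFormFactor (α + β) T) ≤
      ∫ β in (-(lam + h))..(lam + h), (lam + h - |β|) * montgomeryFormFactor (α + β) T := by
  have hF0 : ∀ β, 0 ≤ montgomeryFormFactor (α + β) T := fun β ↦
    Montgomery.montgomeryFormFactor_nonneg _ hT
  have hFc : Continuous fun β ↦ montgomeryFormFactor (α + β) T :=
    (RudnickSarnak.continuous_montgomeryFormFactor T).comp (continuous_const.add continuous_id)
  have hci : ∀ (c : ℝ) (a b : ℝ), IntervalIntegrable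
      (fun β ↦ (c - |β|) * montgomeryFormFactor (α + β) T) volume a b := fun c a b ↦
    ((continuous_const.sub continuous_abs).mul hFc).intervalIntegrable a b
  -- split the big integral at `-lam` and `lam`
  rw [← intervalIntegral.integral_add_adjacent_intervals (hci _ (-(lam + h)) (-lam))
      (hci _ (-lam) (lam + h)),
    ← intervalIntegral.integral_add_adjacent_intervals (hci _ (-lam) lam) (hci _ lam (lam + h))]
  -- the middle piece is exactly the left-hand side
  have hmid : (∫ β in (-lam)..lam, (lam + h - |β|) * montgomeryFormFactor (α + β) T) =
      h * (∫ β in (-lam)..lam, montgomeryFormFactor (α + β) T) +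
        ∫ β in (-lam)..lam, (lam - |β|) * montgomeryFormFactor (α + β) T := by
    rw [← intervalIntegral.integral_const_mul, ← intervalIntegral.integral_add
      ((hFc.intervalIntegrable _ _).const_mul h) (hci _ _ _)]
    refine intervalIntegral.integral_congr fun β _ ↦ ?_
    ring
  -- the outer pieces are non-negative
  have hleft : 0 ≤ ∫ β in (-(lam + h))..(-lam), (lam + h - |β|) * montgomeryFormFactor (α + β) T := by
    refine intervalIntegral.integral_nonneg (by linarith) fun β hβ ↦ ?_
    have : |β| ≤ lam + h := abs_le.mpr ⟨by linarith [hβ.1], by linarith [hβ.2]⟩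
    exact mul_nonneg (by linarith) (hF0 β)
  have hright : 0 ≤ ∫ β in lam..(lam + h), (lam + h - |β|) * montgomeryFormFactor (α + β) T := by
    refine intervalIntegral.integral_nonneg (by linarith) fun β hβ ↦ ?_
    have : |β| ≤ lam + h := abs_le.mpr ⟨by linarith [hβ.1], by linarith [hβ.2]⟩
    exact mul_nonneg (by linarith) (hF0 β)
  rw [hmid]
  linarith

/-- **(F-Hthm4), lower half**: for `T > 1`, `0 < h < λ`,
`H_λ(α) − h ∫_{−λ}^{λ} F(α+β) dβ ≤ H_{λ−h}(α)`, since `k_λ − k_{λ−h} ≤ h` on `[−λ, λ]` and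
`k_λ − h ≤ 0` off `[−(λ−h), λ−h]`. [cite: BaluyotGoldstonSuriajayaTurnageButterbaugh2025, §6 (F-Hthm4)] -/
theorem integral_window_sub_le {T : ℝ} (hT : 1 < T) {lam h : ℝ} (hh : 0 < h) (hhl : h < lam)
    (α : ℝ) :
    (∫ β in (-lam)..lam, (lam - |β|) * montgomeryFormFactor (α + β) T) -
        h * (∫ β in (-lam)..lam, montgomeryFormFactor (α + β) T) ≤
      ∫ β in (-(lam - h))..(lam - h), (lam - h - |β|) * montgomeryFormFactor (α + β) T := by
  have hF0 : ∀ β, 0 ≤ montgomeryFormFactor (α + β) T := fun β ↦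
    Montgomery.montgomeryFormFactor_nonneg _ hT
  have hFc : Continuous fun β ↦ montgomeryFormFactor (α + β) T :=
    (RudnickSarnak.continuous_montgomeryFormFactor T).comp (continuous_const.add continuous_id)
  have hci : ∀ (c : ℝ) (a b : ℝ), IntervalIntegrable
      (fun β ↦ (c - |β|) * montgomeryFormFactor (α + β) T) volume a b := fun c a b ↦
    ((continuous_const.sub continuous_abs).mul hFc).intervalIntegrable a b
  -- the left-hand side is `∫_{-lam}^{lam} (lam - h - |β|) F`
  have hlhs : (∫ β in (-lam)..lam, (lam - |β|) * montgomeryFormFactor (α + β) T) -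
      h * (∫ β in (-lam)..lam, montgomeryFormFactor (α + β) T) =
      ∫ β in (-lam)..lam, (lam - h - |β|) * montgomeryFormFactor (α + β) T := by
    rw [← intervalIntegral.integral_const_mul, ← intervalIntegral.integral_sub (hci _ _ _)
      ((hFc.intervalIntegrable _ _).const_mul h)]
    refine intervalIntegral.integral_congr fun β _ ↦ ?_
    ring
  rw [hlhs, ← intervalIntegral.integral_add_adjacent_intervals (hci _ (-lam) (-(lam - h)))
      (hci _ (-(lam - h)) lam),
    ← intervalIntegral.integral_add_adjacent_intervals (hci _ (-(lam - h)) (lam - h))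
      (hci _ (lam - h) lam)]
  have hleft : ∫ β in (-lam)..(-(lam - h)), (lam - h - |β|) * montgomeryFormFactor (α + β) T ≤ 0 := by
    rw [intervalIntegral.integral_of_le (by linarith)]
    refine setIntegral_nonpos measurableSet_Ioc fun β hβ ↦ ?_
    have : lam - h ≤ |β| := by
      rw [abs_of_neg (by linarith [hβ.2])]
      linarith [hβ.2]
    exact mul_nonpos_of_nonpos_of_nonneg (by linarith) (hF0 β)
  have hright : ∫ β in (lam - h)..lam, (lam - h - |β|) * montgomeryFormFactor (α + β) T ≤ 0 := by
    rw [intervalIntegral.integral_of_le (by linarith)]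
    refine setIntegral_nonpos measurableSet_Ioc fun β hβ ↦ ?_
    have : lam - h ≤ |β| := by
      rw [abs_of_pos (by linarith [hβ.1])]
      exact hβ.1.le
    exact mul_nonpos_of_nonpos_of_nonneg (by linarith) (hF0 β)
  linarith

end AH

/-! ## §2. Lemma 6 (iv): the windows at `±1` (RH only) -/

/-- **BGSTB 2025, Lemma 6 (iv) — PROVED (assuming RH only).** "If `K = ±1`, then … for
`0 < λ ≤ 1/4`, `∫_{1−λ}^{1+λ} F(β) dβ = ∫_1^{1+λ} F(β) dβ + O(λ)` and
`∫_{−1−λ}^{−1+λ} F(β) dβ = ∫_{−1−λ}^{−1} F(β) dβ + O(λ)`." Printed proof (§6, p0015): "By (MT) we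
have `F(w) ≪ 1` for `1 − λ ≤ w ≤ 1`" — here the tree's `AH.exists_abs_formFactor_le_near_one`
(`|F| ≤ C` on `½ ≤ |α| ≤ 1`, from Montgomery's argument under RH) and `F ≥ 0`. These are
conjuncts 3–4 of the claim `bgstb2025_lemma6` verbatim, with their own constant; they do not depend
on AH-Pairs. Unaffected by E-ah-5.
[cite: BaluyotGoldstonSuriajayaTurnageButterbaugh2025, Lemma 6 (iv)] -/
theorem bgstb2025_lemma6_iv (hRH : RiemannHypothesis) :
    ∃ C : ℝ, ∀ᶠ T : ℝ in atTop, ∀ lam : ℝ, 0 < lam → lam ≤ 1 / 4 →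
      |(∫ β in (1 - lam)..(1 + lam), montgomeryFormFactor β T) -
          ∫ β in (1 : ℝ)..(1 + lam), montgomeryFormFactor β T| ≤ C * lam ∧
      |(∫ β in (-1 - lam)..(-1 + lam), montgomeryFormFactor β T) -
          ∫ β in (-1 - lam)..(-1 : ℝ), montgomeryFormFactor β T| ≤ C * lam := by
  obtain ⟨C, hC0, hC⟩ := AH.exists_abs_formFactor_le_near_one hRH
  refine ⟨C, ?_⟩
  filter_upwards [eventually_ge_atTop (2 : ℝ)] with T hT lam hlam hlam4
  have hFc : Continuous fun β ↦ montgomeryFormFactor β T :=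
    RudnickSarnak.continuous_montgomeryFormFactor T
  have hii : ∀ a b, IntervalIntegrable (fun β ↦ montgomeryFormFactor β T) volume a b :=
    fun a b ↦ hFc.intervalIntegrable a b
  constructor
  · rw [← intervalIntegral.integral_add_adjacent_intervals (hii (1 - lam) 1) (hii 1 (1 + lam)),
      add_sub_cancel_right]
    have h := intervalIntegral.norm_integral_le_of_norm_le_const (a := 1 - lam) (b := 1) (C := C)
      (f := fun β ↦ montgomeryFormFactor β T) fun x hx ↦ by
        rw [uIoc_of_le (by linarith)] at hx
        rw [Real.norm_eq_abs]
        have hx0 : 0 < x := by linarith [hx.1]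
        exact hC T hT x (by rw [abs_of_pos hx0]; linarith [hx.1]) (by rw [abs_of_pos hx0]; exact hx.2)
    rw [Real.norm_eq_abs] at h
    simpa [abs_of_pos hlam] using h
  · rw [← intervalIntegral.integral_add_adjacent_intervals (hii (-1 - lam) (-1)) (hii (-1) (-1 + lam)),
      add_sub_cancel_left]
    have h := intervalIntegral.norm_integral_le_of_norm_le_const (a := -1) (b := -1 + lam) (C := C)
      (f := fun β ↦ montgomeryFormFactor β T) fun x hx ↦ by
        rw [uIoc_of_le (by linarith)] at hx
        rw [Real.norm_eq_abs]
        have hx1 : x < 0 := by linarith [hx.2]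
        exact hC T hT x (by rw [abs_of_neg hx1]; linarith [hx.2]) (by rw [abs_of_neg hx1]; linarith [hx.1])
    rw [Real.norm_eq_abs] at h
    simpa [abs_of_pos hlam] using h

/-! ## §3. Lemma 6 (i): the windows at the even integers, modulo Lemma 5 (i)–(ii) -/

/-- **BGSTB 2025, Lemma 6 (i), modulo Lemma 5 (i)–(ii).** "Assume the Riemann Hypothesis and
AH-Pairs. Then for `L ∈ ℤ` and `0 < λ ≤ 1/4` we have
`∫_{2L−λ}^{2L+λ} F(β) dβ = 1 + O(λ²) + O(λ E_G(λ, L)) + O(1/(λ √log T))`." This is the first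
conjunct of the claim `bgstb2025_lemma6` verbatim (same quantifier block), proved from the named fact
`bgstb2025_lemma5_rh` (Lemma 5 (i)–(ii), the RH half; only (i) at `α = 0` is used) and the tree's
PROVED corrected AH half `bgstb2025_lemma5_ah_of_RH` ((iv) with `|L|`, at `α = 0`). Printed proof
(§6, p0014:L44–L72; OUR PARAPHRASE): `H_λ(2L) = λ² G_λ(2L) = λ + O(λ³) + O(1/√log T) + O(λ² E_G(λ, L))`,
then the differencing (F-Hthm4) with `λ/4 ≤ h ≤ λ/2` — here `h = λ/2`, at the three radii
`λ/2, λ, 3λ/2` (all `≤ 3/8 ≤ 1/2`, inside Lemma 5's range), and `E_G(μ, 2|L|) ≤ 4 E_G(λ, L)` for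
`λ/2 ≤ μ` (our bookkeeping for "combined and slightly degraded"). Unaffected by E-ah-5.
[cite: BaluyotGoldstonSuriajayaTurnageButterbaugh2025, Lemma 6 (i) and §6] -/
theorem bgstb2025_lemma6_i_of_lemma5_rh (h5 : bgstb2025_lemma5_rh) (hRH : RiemannHypothesis) :
    ∀ M : ℝ, 0 < M → ∀ R : ℝ → ℝ, AH.IsPairsRate M R → ∀ δ : ℝ, 0 < δ → δ ≤ 1 / 2 →
      ∃ C : ℝ, ∀ᶠ T : ℝ in atTop, ∀ lam : ℝ, 0 < lam → lam ≤ 1 / 4 → ∀ L : ℤ,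
        |(∫ β in (2 * L - lam)..(2 * L + lam), montgomeryFormFactor β T) - 1| ≤
          C * (lam ^ 2 + lam * AH.errG M (R T) T lam L + 1 / (lam * Real.sqrt (Real.log T))) := by
  intro M hM R hR δ hδ hδ2
  obtain ⟨C₁, h₁⟩ := (h5 hRH).2
  obtain ⟨C₂, h₂⟩ := bgstb2025_lemma5_ah_of_RH hRH M hM R hR δ hδ hδ2
  have hR0 : ∀ T, 0 < R T := hR.1
  refine ⟨100 * (|C₁| + |C₂|), ?_⟩
  filter_upwards [h₁, h₂, eventually_gt_atTop (1 : ℝ),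
    Real.tendsto_log_atTop.eventually (eventually_ge_atTop (1 : ℝ))] with T hT₁ hT₂ hT1 hlogT
    lam hlam hlam4 L
  have hlog0 : 0 < Real.log T := by linarith
  have hsq1 : 1 ≤ Real.sqrt (Real.log T) := by
    rw [show (1 : ℝ) = Real.sqrt 1 by simp]
    exact Real.sqrt_le_sqrt hlogT
  have hsq0 : 0 < Real.sqrt (Real.log T) := by linarith
  have hsqle : Real.sqrt (Real.log T) ≤ Real.log T := by
    have h := Real.sq_sqrt hlog0.le
    nlinarith
  have hRT : 0 ≤ R T := (hR0 T).le
  -- abbreviations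
  set F : ℝ → ℝ := fun β ↦ montgomeryFormFactor β T with hF
  set H : ℝ → ℝ := fun μ ↦ μ ^ 2 * AH.heathBrownG μ (2 * L) T with hH
  set E : ℝ := AH.errG M (R T) T lam L with hE
  have hE0 : 0 ≤ E := by
    simp only [hE, AH.errG]
    positivity
  -- (a)+(b): `|H μ − μ| ≤ Δ(μ)` for `λ/2 ≤ μ ≤ 3λ/2`
  have hΔ : ∀ μ : ℝ, lam / 2 ≤ μ → μ ≤ 3 * lam / 2 →
      |H μ - μ| ≤ |C₁| * (μ ^ 3 + μ / Real.sqrt (Real.log T) + 1 / Real.log T) +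
        |C₂| * μ ^ 2 * (4 * E) := by
    intro μ hμ1 hμ2
    have hμ0 : 0 < μ := by linarith
    have hμ12 : μ ≤ 1 / 2 := by linarith
    -- (a) Lemma 5 (i) at `α = 0`
    have ha := ((hT₁ μ hμ0 hμ12 0).1 (by simpa using hμ0))
    rw [abs_zero, sub_zero] at ha
    -- (b) Lemma 5 (iv) at `α = 0`
    have hb := (hT₂ μ hμ0 hμ12 0).2 L
    rw [zero_add, abs_zero, zero_add] at hb
    -- `E_G(μ, 2|L|) ≤ 4 E`
    have hEμ : AH.errG M (R T) T μ (2 * |(L : ℝ)|) ≤ 4 * E := by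
      simp only [hE, AH.errG]
      rw [abs_mul, abs_two, abs_abs]
      have h1 : 1 / (μ ^ 2 * M) ≤ 4 * (1 / (lam ^ 2 * M)) := by
        rw [div_le_iff₀ (by positivity), show 4 * (1 / (lam ^ 2 * M)) * (μ ^ 2 * M) =
          (2 * μ) ^ 2 / lam ^ 2 by field_simp; ring]
        rw [le_div_iff₀ (by positivity), one_mul]
        exact pow_le_pow_left₀ hlam.le (by linarith) 2
      have h2 : (2 * |(L : ℝ)| + 1) * M ^ 2 * R T ≤ 4 * ((|(L : ℝ)| + 1) * M ^ 2 * R T) := by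
        have : 0 ≤ M ^ 2 * R T := by positivity
        nlinarith [abs_nonneg (L : ℝ)]
      have h3 : 1 / Real.log T ≤ 4 * (1 / Real.log T) := by
        have : 0 ≤ 1 / Real.log T := by positivity
        linarith
      linarith
    -- combine
    have hC₁ : C₁ * (μ + 1 / (μ * Real.sqrt (Real.log T)) + 1 / (μ ^ 2 * Real.log T)) ≤
        |C₁| * (μ + 1 / (μ * Real.sqrt (Real.log T)) + 1 / (μ ^ 2 * Real.log T)) :=
      mul_le_mul_of_nonneg_right (le_abs_self _) (by positivity)
    have hC₂ : C₂ * AH.errG M (R T) T μ (2 * |(L : ℝ)|) ≤ |C₂| * (4 * E) := by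
      calc C₂ * AH.errG M (R T) T μ (2 * |(L : ℝ)|) ≤ |C₂| * AH.errG M (R T) T μ (2 * |(L : ℝ)|) :=
            mul_le_mul_of_nonneg_right (le_abs_self _) (by simp only [AH.errG]; positivity)
        _ ≤ |C₂| * (4 * E) := mul_le_mul_of_nonneg_left hEμ (abs_nonneg _)
    have hGa : |AH.heathBrownG μ 0 T - 1 / μ| ≤
        |C₁| * (μ + 1 / (μ * Real.sqrt (Real.log T)) + 1 / (μ ^ 2 * Real.log T)) := by
      have : μ / μ ^ 2 = 1 / μ := by field_simp
      rw [this] at ha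
      exact ha.trans hC₁
    have hGb : |AH.heathBrownG μ (2 * L) T - AH.heathBrownG μ 0 T| ≤ |C₂| * (4 * E) :=
      hb.trans hC₂
    -- `H μ − μ = μ² (G_μ(2L) − G_μ(0)) + μ² (G_μ(0) − 1/μ)`
    have hsplit : H μ - μ = μ ^ 2 * (AH.heathBrownG μ (2 * L) T - AH.heathBrownG μ 0 T) +
        μ ^ 2 * (AH.heathBrownG μ 0 T - 1 / μ) := by
      simp only [hH]
      field_simp
      ring
    rw [hsplit]
    calc |μ ^ 2 * (AH.heathBrownG μ (2 * L) T - AH.heathBrownG μ 0 T) +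
          μ ^ 2 * (AH.heathBrownG μ 0 T - 1 / μ)|
        ≤ μ ^ 2 * |AH.heathBrownG μ (2 * L) T - AH.heathBrownG μ 0 T| +
          μ ^ 2 * |AH.heathBrownG μ 0 T - 1 / μ| := by
          refine (abs_add_le _ _).trans ?_
          rw [abs_mul, abs_mul, abs_of_nonneg (sq_nonneg μ)]
      _ ≤ μ ^ 2 * (|C₂| * (4 * E)) +
          μ ^ 2 * (|C₁| * (μ + 1 / (μ * Real.sqrt (Real.log T)) + 1 / (μ ^ 2 * Real.log T))) := by
          gcongr
      _ = |C₁| * (μ ^ 3 + μ / Real.sqrt (Real.log T) + 1 / Real.log T) +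
          |C₂| * μ ^ 2 * (4 * E) := by
          field_simp
          ring
  -- (c) each `Δ(μ)`, divided by `h = λ/2`, is within the target shape
  have hΔ' : ∀ μ : ℝ, lam / 2 ≤ μ → μ ≤ 3 * lam / 2 →
      2 / lam * |H μ - μ| ≤ 30 * (|C₁| + |C₂|) *
        (lam ^ 2 + lam * E + 1 / (lam * Real.sqrt (Real.log T))) := by
    intro μ hμ1 hμ2
    have hμ0 : 0 < μ := by linarith
    have h := hΔ μ hμ1 hμ2
    have hA : 0 ≤ |C₁| := abs_nonneg _
    have hB : 0 ≤ |C₂| := abs_nonneg _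
    -- bound each term
    have t1 : 2 / lam * (|C₁| * μ ^ 3) ≤ |C₁| * (7 * lam ^ 2) := by
      have : μ ^ 3 ≤ (3 * lam / 2) ^ 3 := pow_le_pow_left₀ hμ0.le hμ2 3
      have e := mul_le_mul_of_nonneg_left this hA
      have e' := mul_nonneg hA (pow_nonneg hlam.le 3)
      rw [div_mul_eq_mul_div, div_le_iff₀ hlam]
      linarith
    have t2 : 2 / lam * (|C₁| * (μ / Real.sqrt (Real.log T))) ≤
        |C₁| * (3 * (1 / (lam * Real.sqrt (Real.log T)))) := by
      -- `2μ/λ ≤ 3` and `1 ≤ 1/(4λ)`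
      have h3 : 2 / lam * μ ≤ 3 := by
        rw [div_mul_eq_mul_div, div_le_iff₀ hlam]; linarith
      have h4 : (3 : ℝ) / Real.sqrt (Real.log T) ≤ 3 * (1 / (lam * Real.sqrt (Real.log T))) := by
        rw [div_le_iff₀ hsq0]
        have : 1 / (lam * Real.sqrt (Real.log T)) * Real.sqrt (Real.log T) = 1 / lam := by
          field_simp
        rw [mul_assoc, this]
        have : (1 : ℝ) ≤ 1 / lam := by rw [le_div_iff₀ hlam]; linarith
        linarith
      calc 2 / lam * (|C₁| * (μ / Real.sqrt (Real.log T)))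
          = |C₁| * ((2 / lam * μ) / Real.sqrt (Real.log T)) := by ring
        _ ≤ |C₁| * (3 / Real.sqrt (Real.log T)) := by gcongr
        _ ≤ |C₁| * (3 * (1 / (lam * Real.sqrt (Real.log T)))) := by gcongr
    have t3 : 2 / lam * (|C₁| * (1 / Real.log T)) ≤
        |C₁| * (2 * (1 / (lam * Real.sqrt (Real.log T)))) := by
      have : 1 / Real.log T ≤ 1 / Real.sqrt (Real.log T) :=
        one_div_le_one_div_of_le hsq0 hsqle
      calc 2 / lam * (|C₁| * (1 / Real.log T)) ≤ 2 / lam * (|C₁| * (1 / Real.sqrt (Real.log T))) := by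
            gcongr
        _ = |C₁| * (2 * (1 / (lam * Real.sqrt (Real.log T)))) := by
            field_simp
    have t4 : 2 / lam * (|C₂| * μ ^ 2 * (4 * E)) ≤ |C₂| * (18 * (lam * E)) := by
      have : μ ^ 2 ≤ (3 * lam / 2) ^ 2 := pow_le_pow_left₀ hμ0.le hμ2 2
      have h' : 2 / lam * μ ^ 2 ≤ 9 / 2 * lam := by
        rw [div_mul_eq_mul_div, div_le_iff₀ hlam]; nlinarith
      calc 2 / lam * (|C₂| * μ ^ 2 * (4 * E)) = |C₂| * (4 * E) * (2 / lam * μ ^ 2) := by ring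
        _ ≤ |C₂| * (4 * E) * (9 / 2 * lam) := by gcongr
        _ = |C₂| * (18 * (lam * E)) := by ring
    have hpos1 : 0 ≤ lam ^ 2 := sq_nonneg _
    have hpos2 : 0 ≤ lam * E := by positivity
    have hpos3 : 0 ≤ 1 / (lam * Real.sqrt (Real.log T)) := by positivity
    calc 2 / lam * |H μ - μ|
        ≤ 2 / lam * (|C₁| * (μ ^ 3 + μ / Real.sqrt (Real.log T) + 1 / Real.log T) +
            |C₂| * μ ^ 2 * (4 * E)) := by gcongr
      _ = 2 / lam * (|C₁| * μ ^ 3) + 2 / lam * (|C₁| * (μ / Real.sqrt (Real.log T))) +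
            2 / lam * (|C₁| * (1 / Real.log T)) + 2 / lam * (|C₂| * μ ^ 2 * (4 * E)) := by ring
      _ ≤ |C₁| * (7 * lam ^ 2) + |C₁| * (3 * (1 / (lam * Real.sqrt (Real.log T)))) +
            |C₁| * (2 * (1 / (lam * Real.sqrt (Real.log T)))) + |C₂| * (18 * (lam * E)) := by
          linarith
      _ ≤ 30 * (|C₁| + |C₂|) * (lam ^ 2 + lam * E + 1 / (lam * Real.sqrt (Real.log T))) := by
          have e1 := mul_nonneg hA hpos1
          have e2 := mul_nonneg hA hpos2
          have e3 := mul_nonneg hA hpos3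
          have e4 := mul_nonneg hB hpos1
          have e5 := mul_nonneg hB hpos2
          have e6 := mul_nonneg hB hpos3
          linarith
  -- (d) the differencing, at `h = λ/2`
  set I : ℝ := ∫ β in (-lam)..lam, montgomeryFormFactor (2 * L + β) T with hI
  have hup := AH.integral_window_add_le hT1 hlam (half_pos hlam) (2 * (L : ℝ))
  have hlow := AH.integral_window_sub_le hT1 (half_pos hlam) (by linarith : lam / 2 < lam)
    (2 * (L : ℝ))
  have hHlam : H lam = ∫ β in (-lam)..lam, (lam - |β|) * montgomeryFormFactor (2 * L + β) T := by
    simp only [hH]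
    exact AH.sq_mul_heathBrownG hlam.ne' _ _
  have hHup : H (lam + lam / 2) =
      ∫ β in (-(lam + lam / 2))..(lam + lam / 2),
        (lam + lam / 2 - |β|) * montgomeryFormFactor (2 * L + β) T := by
    simp only [hH]
    exact AH.sq_mul_heathBrownG (by linarith) _ _
  have hHlow : H (lam - lam / 2) =
      ∫ β in (-(lam - lam / 2))..(lam - lam / 2),
        (lam - lam / 2 - |β|) * montgomeryFormFactor (2 * L + β) T := by
    simp only [hH]
    exact AH.sq_mul_heathBrownG (by linarith) _ _
  rw [← hHlam, ← hHup] at hup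
  rw [← hHlam, ← hHlow] at hlow
  -- `hup : λ/2 · I + H λ ≤ H(3λ/2)`, `hlow : H λ − λ/2 · I ≤ H(λ/2)`
  have hΔ1 := hΔ' lam (by linarith) (by linarith)
  have hΔ2 := hΔ' (lam + lam / 2) (by linarith) (by linarith)
  have hΔ3 := hΔ' (lam - lam / 2) (by linarith) (by linarith)
  set A : ℝ := 30 * (|C₁| + |C₂|) * (lam ^ 2 + lam * E + 1 / (lam * Real.sqrt (Real.log T)))
    with hA
  -- from `|H μ − μ| ≤ (λ/2) A`:
  have hb1 : |H lam - lam| ≤ lam / 2 * A := by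
    have := hΔ1; rw [div_mul_eq_mul_div, div_le_iff₀ hlam] at this; linarith
  have hb2 : |H (lam + lam / 2) - (lam + lam / 2)| ≤ lam / 2 * A := by
    have := hΔ2; rw [div_mul_eq_mul_div, div_le_iff₀ hlam] at this; linarith
  have hb3 : |H (lam - lam / 2) - (lam - lam / 2)| ≤ lam / 2 * A := by
    have := hΔ3; rw [div_mul_eq_mul_div, div_le_iff₀ hlam] at this; linarith
  have hI1 : I - 1 ≤ 2 * A := by
    -- `λ/2 · I ≤ H(3λ/2) − H λ ≤ λ/2 + λ A`
    have h1 := (abs_le.mp hb2).2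
    have h2 := (abs_le.mp hb1).1
    have key : lam / 2 * I ≤ lam / 2 * (1 + 2 * A) := by linarith
    have := le_of_mul_le_mul_left key (half_pos hlam)
    linarith
  have hI2 : -(2 * A) ≤ I - 1 := by
    -- `λ/2 · I ≥ H λ − H(λ/2) ≥ λ/2 − λ A`
    have h1 := (abs_le.mp hb1).1
    have h2 := (abs_le.mp hb3).2
    have key : lam / 2 * (1 - 2 * A) ≤ lam / 2 * I := by linarith
    have := le_of_mul_le_mul_left key (half_pos hlam)
    linarith
  -- (e) rewrite the window integral and conclude
  have hIeq : (∫ β in (2 * L - lam)..(2 * L + lam), montgomeryFormFactor β T) = I := by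
    rw [hI, intervalIntegral.integral_comp_add_left (fun β ↦ montgomeryFormFactor β T) (2 * (L : ℝ)),
      sub_eq_add_neg]
  rw [hIeq]
  have hfin : |I - 1| ≤ 2 * A := abs_le.mpr ⟨hI2, hI1⟩
  refine hfin.trans ?_
  rw [hA]
  have : 0 ≤ lam ^ 2 + lam * E + 1 / (lam * Real.sqrt (Real.log T)) := by positivity
  have e := mul_nonneg (add_nonneg (abs_nonneg C₁) (abs_nonneg C₂)) this
  linarith

/-- **BGSTB 2025, Lemma 6 (i) — proved outright from RH** (for every AH-Pairs datum `(M, R)` and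
bin half-width `δ`, as typed): conjunct (i) of the claim `bgstb2025_lemma6` verbatim, by
`bgstb2025_lemma6_i_of_lemma5_rh` and the tree's discharge `bgstb2025_lemma5_rh_holds` of
Lemma 5 (i)–(ii) (`AlternativeHypothesisFormFactorRHProofs`, from Montgomery's theorem with the
Goldston–Montgomery rate). RH is the printed antecedent.
[cite: BaluyotGoldstonSuriajayaTurnageButterbaugh2025, Lemma 6 (i)] -/
theorem bgstb2025_lemma6_i (hRH : RiemannHypothesis) :
    ∀ M : ℝ, 0 < M → ∀ R : ℝ → ℝ, AH.IsPairsRate M R → ∀ δ : ℝ, 0 < δ → δ ≤ 1 / 2 →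
      ∃ C : ℝ, ∀ᶠ T : ℝ in atTop, ∀ lam : ℝ, 0 < lam → lam ≤ 1 / 4 → ∀ L : ℤ,
        |(∫ β in (2 * L - lam)..(2 * L + lam), montgomeryFormFactor β T) - 1| ≤
          C * (lam ^ 2 + lam * AH.errG M (R T) T lam L + 1 / (lam * Real.sqrt (Real.log T))) :=
  bgstb2025_lemma6_i_of_lemma5_rh bgstb2025_lemma5_rh_holds hRH

namespace AH

/-! ## §4. ERRATUM E-ah-5 — the true Fubini identity for `∫ G_λ` (ζ-free kernel theorems)

Printed (§6, proof of Lemma 6 (iii)–(v), p0015:L9–L15 = TeX l.1013–1018):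
"`∫_{1−λ}^{1+λ} G_λ(α) dα = ∫_{1−λ}^{1+λ} (1/λ²) ∫_{−λ}^{λ} (λ − |β|) F(α + β) dβ dα
 = (1/λ²) ∫_{1−λ}^{1+λ} ∫_{α−λ}^{α+λ} (λ − |w − α|) F(w) dw dα
 = (1/λ²) ∫_{1−2λ}^{1+2λ} F(w) (∫_{w−λ}^{w+λ} (λ − |w − α|) dα) dw = ∫_{1−2λ}^{1+2λ} F(w) dw`".
OUR READING (gloss, not a quotation): the third equality is false — after the interchange `α`
ranges over `[1−λ, 1+λ] ∩ [w−λ, w+λ]`, which is `[w−λ, w+λ]` only at `w = 1`. The true identity,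
for ANY continuous `F` and centre `c` (`integral_integral_tent_eq`):
`∫_{c−λ}^{c+λ} ∫_{−λ}^{λ} (λ − |β|) F(α + β) dβ dα = ∫_{−2λ}^{2λ} Φ_λ(u) F(c + u) du`,
`Φ_λ(u) := ∫_{−λ}^{λ} (λ − |u − s|)₊ ds = λ² − u²/2 (|u| ≤ λ), (2λ − |u|)²/2 (λ ≤ |u| ≤ 2λ)`
(`integral_tentWindow`): a tent-smoothed window with `0 ≤ Φ_λ ≤ λ²`, `Φ_λ ≥ λ²/2` on `|u| ≤ λ`
(`tentWindow_bounds`) and mass `∫ Φ_λ = 2λ³` (`integral_tentWindow_weight`), i.e. `φ_λ = Φ_λ/λ²`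
has mass `2λ`, whereas the printed right-hand side is the flat window of mass `4λ`: for `F ≡ a`
the two sides are `2λa ≠ 4λa` (`integral_integral_tent_const`, `bgstb2025_lemma6_printed_display_fails`).
What survives for `F ≥ 0`: the printed display as the INEQUALITY `∫_{c−λ}^{c+λ} G_λ ≤ ∫_{c−2λ}^{c+2λ} F`
(`integral_heathBrownG_le_window`) and `½ ∫_{c−λ}^{c+λ} F ≤ ∫_{c−λ}^{c+λ} G_λ`
(`half_integral_window_le_integral_heathBrownG`). -/

/-- `∫_a^b (p + q s + r s²) ds` (calculus). [folklore] -/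
private theorem integral_quadratic (p q r a b : ℝ) :
    ∫ s in a..b, (p + q * s + r * s ^ 2) =
      p * (b - a) + q * (b ^ 2 - a ^ 2) / 2 + r * (b ^ 3 - a ^ 3) / 3 := by
  have hderiv : ∀ x ∈ Set.uIcc a b,
      HasDerivAt (fun s : ℝ ↦ p * s + q / 2 * (s * s) + r / 3 * (s * s * s))
        (p + q * x + r * x ^ 2) x := by
    intro x _
    have h0 : HasDerivAt (fun s : ℝ ↦ s) 1 x := hasDerivAt_id x
    have h1 := h0.const_mul p
    have h2 := (h0.mul h0).const_mul (q / 2)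
    have h3 := ((h0.mul h0).mul h0).const_mul (r / 3)
    refine ((h1.add h2).add h3).congr_deriv ?_
    simp only [Pi.mul_apply]
    ring
  rw [intervalIntegral.integral_eq_sub_of_hasDerivAt hderiv
    ((by fun_prop : Continuous fun s : ℝ ↦ p + q * s + r * s ^ 2).intervalIntegrable _ _)]
  ring

/-- `∫_{−λ}^{λ} (λ − |β|) dβ = λ²` (the tent `k_λ` has mass `λ²`). [folklore] -/
private theorem integral_tent {lam : ℝ} (hlam : 0 < lam) :
    ∫ β in (-lam)..lam, (lam - |β|) = lam ^ 2 := by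
  have hcont : Continuous fun β : ℝ ↦ lam - |β| := by fun_prop
  rw [← intervalIntegral.integral_add_adjacent_intervals (hcont.intervalIntegrable (-lam) 0)
    (hcont.intervalIntegrable 0 lam)]
  have h1 : ∫ β in (-lam)..0, (lam - |β|) = ∫ β in (-lam)..0, (lam + 1 * β + 0 * β ^ 2) := by
    refine intervalIntegral.integral_congr fun β hβ ↦ ?_
    rw [Set.uIcc_of_le (by linarith)] at hβ
    simp only [abs_of_nonpos hβ.2]
    ring
  have h2 : ∫ β in (0 : ℝ)..lam, (lam - |β|) =
      ∫ β in (0 : ℝ)..lam, (lam + (-1) * β + 0 * β ^ 2) := by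
    refine intervalIntegral.integral_congr fun β hβ ↦ ?_
    rw [Set.uIcc_of_le hlam.le] at hβ
    simp only [abs_of_nonneg hβ.1]
    ring
  rw [h1, h2, integral_quadratic, integral_quadratic]
  ring

/-- The tent-smoothed window weight in closed form, `0 ≤ u ≤ 2λ` (elementary calculus). [folklore] -/
private theorem integral_tentWindow_of_nonneg {lam u : ℝ} (hlam : 0 < lam) (hu0 : 0 ≤ u)
    (hu : u ≤ 2 * lam) :
    ∫ s in (-lam)..lam, max (lam - |u - s|) 0 =
      if u ≤ lam then lam ^ 2 - u ^ 2 / 2 else (2 * lam - u) ^ 2 / 2 := by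
  have hcont : Continuous fun s : ℝ ↦ max (lam - |u - s|) 0 :=
    (continuous_const.sub ((continuous_const.sub continuous_id).abs)).max continuous_const
  have hii : ∀ a b : ℝ, IntervalIntegrable (fun s : ℝ ↦ max (lam - |u - s|) 0) volume a b :=
    fun a b ↦ hcont.intervalIntegrable a b
  -- on `[−λ, u − λ]` the integrand vanishes
  have p1 : ∫ s in (-lam)..(u - lam), max (lam - |u - s|) 0 = 0 := by
    calc ∫ s in (-lam)..(u - lam), max (lam - |u - s|) 0
        = ∫ s in (-lam)..(u - lam), (0 : ℝ) := by
          refine intervalIntegral.integral_congr fun s hs ↦ ?_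
          rw [Set.uIcc_of_le (by linarith)] at hs
          have : lam ≤ |u - s| := by
            rw [abs_of_nonneg (by linarith [hs.2])]
            linarith [hs.2]
          exact max_eq_right (by linarith)
      _ = 0 := intervalIntegral.integral_zero
  split_ifs with hul
  · -- `[u − λ, u]`: integrand `λ − u + s`; `[u, λ]`: integrand `λ + u − s`
    have p2 : ∫ s in (u - lam)..u, max (lam - |u - s|) 0 =
        ∫ s in (u - lam)..u, ((lam - u) + 1 * s + 0 * s ^ 2) := by
      refine intervalIntegral.integral_congr fun s hs ↦ ?_
      rw [Set.uIcc_of_le (by linarith)] at hs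
      show max (lam - |u - s|) 0 = (lam - u) + 1 * s + 0 * s ^ 2
      rw [abs_of_nonneg (by linarith [hs.2]), max_eq_left (by linarith [hs.1])]
      ring
    have p3 : ∫ s in u..lam, max (lam - |u - s|) 0 =
        ∫ s in u..lam, ((lam + u) + (-1) * s + 0 * s ^ 2) := by
      refine intervalIntegral.integral_congr fun s hs ↦ ?_
      rw [Set.uIcc_of_le hul] at hs
      show max (lam - |u - s|) 0 = (lam + u) + (-1) * s + 0 * s ^ 2
      rw [abs_of_nonpos (by linarith [hs.1]), max_eq_left (by linarith [hs.2])]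
      ring
    rw [← intervalIntegral.integral_add_adjacent_intervals (hii (-lam) (u - lam))
        (hii (u - lam) lam),
      ← intervalIntegral.integral_add_adjacent_intervals (hii (u - lam) u) (hii u lam), p1, p2, p3,
      integral_quadratic, integral_quadratic]
    ring
  · push Not at hul
    have p2 : ∫ s in (u - lam)..lam, max (lam - |u - s|) 0 =
        ∫ s in (u - lam)..lam, ((lam - u) + 1 * s + 0 * s ^ 2) := by
      refine intervalIntegral.integral_congr fun s hs ↦ ?_
      rw [Set.uIcc_of_le (by linarith)] at hs
      show max (lam - |u - s|) 0 = (lam - u) + 1 * s + 0 * s ^ 2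
      rw [abs_of_nonneg (by linarith [hs.2]), max_eq_left (by linarith [hs.1])]
      ring
    rw [← intervalIntegral.integral_add_adjacent_intervals (hii (-lam) (u - lam))
        (hii (u - lam) lam), p1, p2, integral_quadratic]
    ring

/-- **The tent-smoothed window weight `Φ_λ` (E-ah-5).** For `|u| ≤ 2λ`,
`∫_{−λ}^{λ} (λ − |u − s|)₊ ds = λ² − u²/2` if `|u| ≤ λ`, `= (2λ − |u|)²/2` if `λ ≤ |u| ≤ 2λ` — the
inner integral that the printed interchange (proof of Lemma 6 (iii)–(v), p0015:L9–L15) evaluates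
as `λ²` for every `w ∈ [1−2λ, 1+2λ]`. OUR COMPUTATION, correcting the print (E-ah-5).
[cite: BaluyotGoldstonSuriajayaTurnageButterbaugh2025, §6, proof of Lemma 6 (iii)–(v)] -/
theorem integral_tentWindow {lam u : ℝ} (hlam : 0 < lam) (hu : |u| ≤ 2 * lam) :
    ∫ s in (-lam)..lam, max (lam - |u - s|) 0 =
      if |u| ≤ lam then lam ^ 2 - u ^ 2 / 2 else (2 * lam - |u|) ^ 2 / 2 := by
  rcases le_or_gt 0 u with hu0 | hu0
  · rw [abs_of_nonneg hu0] at hu ⊢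
    exact integral_tentWindow_of_nonneg hlam hu0 hu
  · have hrefl : ∫ s in (-lam)..lam, max (lam - |u - s|) 0 =
        ∫ s in (-lam)..lam, max (lam - |-u - s|) 0 := by
      have e := intervalIntegral.integral_comp_neg (a := -lam) (b := lam)
        (fun s ↦ max (lam - |-u - s|) 0)
      rw [neg_neg] at e
      rw [← e]
      refine intervalIntegral.integral_congr fun s _ ↦ ?_
      show max (lam - |u - s|) 0 = max (lam - |-u - -s|) 0
      rw [show -u - -s = -(u - s) by ring, abs_neg]
    rw [hrefl, abs_of_neg hu0]
    have h := integral_tentWindow_of_nonneg hlam (neg_nonneg.mpr hu0.le)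
      (by rwa [abs_of_neg hu0] at hu)
    rw [h, neg_sq]

/-- On `|u| ≤ 2λ`: `0 ≤ Φ_λ(u) ≤ λ²`, and `λ²/2 ≤ Φ_λ(u)` when `|u| ≤ λ` (elementary; E-ah-5).
[cite: BaluyotGoldstonSuriajayaTurnageButterbaugh2025, §6, proof of Lemma 6 (iii)–(v)] -/
theorem tentWindow_bounds {lam u : ℝ} (hu : |u| ≤ 2 * lam) :
    0 ≤ (if |u| ≤ lam then lam ^ 2 - u ^ 2 / 2 else (2 * lam - |u|) ^ 2 / 2) ∧
      (if |u| ≤ lam then lam ^ 2 - u ^ 2 / 2 else (2 * lam - |u|) ^ 2 / 2) ≤ lam ^ 2 ∧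
      (|u| ≤ lam →
        lam ^ 2 / 2 ≤ (if |u| ≤ lam then lam ^ 2 - u ^ 2 / 2 else (2 * lam - |u|) ^ 2 / 2)) := by
  have hu2 : u ^ 2 = |u| ^ 2 := (sq_abs u).symm
  split_ifs with h
  · have : |u| ^ 2 ≤ lam ^ 2 := pow_le_pow_left₀ (abs_nonneg u) h 2
    exact ⟨by nlinarith, by nlinarith [sq_nonneg u], fun _ ↦ by nlinarith⟩
  · push Not at h
    have h1 : 0 ≤ 2 * lam - |u| := by linarith
    have h2 : 2 * lam - |u| ≤ lam := by linarith
    have : (2 * lam - |u|) ^ 2 ≤ lam ^ 2 := pow_le_pow_left₀ h1 h2 2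
    exact ⟨by positivity, by nlinarith [sq_nonneg lam], fun h' ↦ absurd h' (not_le.mpr h)⟩

/-- `Φ_λ` is continuous (the two closed forms agree at `|u| = λ`). [folklore] -/
private theorem continuous_tentWindow (lam : ℝ) :
    Continuous fun u : ℝ ↦
      (if |u| ≤ lam then lam ^ 2 - u ^ 2 / 2 else (2 * lam - |u|) ^ 2 / 2) := by
  refine Continuous.if_le (by fun_prop) (by fun_prop) continuous_abs continuous_const
    fun u hu ↦ ?_
  rw [← sq_abs u, hu]
  ring

/-- For `|s| ≤ λ`: `∫_{−λ}^{λ} (λ − |β|) F(c + s + β) dβ = ∫_{−2λ}^{2λ} (λ − |u − s|)₊ F(c + u) du`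
(substitute `u = s + β`; the truncated tent vanishes off `[s − λ, s + λ] ⊆ [−2λ, 2λ]`). [folklore] -/
private theorem integral_tent_shift {F : ℝ → ℝ} (hF : Continuous F) {lam : ℝ} (hlam : 0 < lam)
    (c : ℝ) {s : ℝ} (hs : |s| ≤ lam) :
    ∫ β in (-lam)..lam, (lam - |β|) * F (c + s + β) =
      ∫ u in (-(2 * lam))..(2 * lam), max (lam - |u - s|) 0 * F (c + u) := by
  have hs' := abs_le.mp hs
  have hcont : Continuous fun u : ℝ ↦ max (lam - |u - s|) 0 * F (c + u) :=
    ((continuous_const.sub ((continuous_id.sub continuous_const).abs)).max continuous_const).mul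
      (hF.comp (continuous_const.add continuous_id))
  have hii : ∀ a b : ℝ,
      IntervalIntegrable (fun u : ℝ ↦ max (lam - |u - s|) 0 * F (c + u)) volume a b :=
    fun a b ↦ hcont.intervalIntegrable a b
  have h1 : ∫ β in (-lam)..lam, (lam - |β|) * F (c + s + β) =
      ∫ u in (s - lam)..(s + lam), max (lam - |u - s|) 0 * F (c + u) := by
    rw [show s - lam = s + -lam by ring,
      ← intervalIntegral.integral_comp_add_left (fun u ↦ max (lam - |u - s|) 0 * F (c + u)) s]
    refine intervalIntegral.integral_congr fun β hβ ↦ ?_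
    rw [Set.uIcc_of_le (by linarith)] at hβ
    have hβ' : |β| ≤ lam := abs_le.mpr ⟨hβ.1, hβ.2⟩
    show (lam - |β|) * F (c + s + β) = max (lam - |s + β - s|) 0 * F (c + (s + β))
    rw [show s + β - s = β by ring, max_eq_left (by linarith), show c + (s + β) = c + s + β by ring]
  have h0l : ∫ u in (-(2 * lam))..(s - lam), max (lam - |u - s|) 0 * F (c + u) = 0 := by
    calc ∫ u in (-(2 * lam))..(s - lam), max (lam - |u - s|) 0 * F (c + u)
        = ∫ u in (-(2 * lam))..(s - lam), (0 : ℝ) := by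
          refine intervalIntegral.integral_congr fun u hu ↦ ?_
          rw [Set.uIcc_of_le (by linarith)] at hu
          have : lam ≤ |u - s| := by
            rw [abs_of_nonpos (by linarith [hu.2])]
            linarith [hu.2]
          show max (lam - |u - s|) 0 * F (c + u) = 0
          rw [max_eq_right (by linarith), zero_mul]
      _ = 0 := intervalIntegral.integral_zero
  have h0r : ∫ u in (s + lam)..(2 * lam), max (lam - |u - s|) 0 * F (c + u) = 0 := by
    calc ∫ u in (s + lam)..(2 * lam), max (lam - |u - s|) 0 * F (c + u)
        = ∫ u in (s + lam)..(2 * lam), (0 : ℝ) := by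
          refine intervalIntegral.integral_congr fun u hu ↦ ?_
          rw [Set.uIcc_of_le (by linarith)] at hu
          have : lam ≤ |u - s| := by
            rw [abs_of_nonneg (by linarith [hu.1])]
            linarith [hu.1]
          show max (lam - |u - s|) 0 * F (c + u) = 0
          rw [max_eq_right (by linarith), zero_mul]
      _ = 0 := intervalIntegral.integral_zero
  rw [h1, ← intervalIntegral.integral_add_adjacent_intervals (hii (-(2 * lam)) (s - lam))
      (hii (s - lam) (2 * lam)),
    ← intervalIntegral.integral_add_adjacent_intervals (hii (s - lam) (s + lam))
      (hii (s + lam) (2 * lam)), h0l, h0r]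
  ring

/-- **ERRATUM E-ah-5 — the true identity, general form.** For every continuous `F : ℝ → ℝ`,
`λ > 0` and centre `c`:
`∫_{c−λ}^{c+λ} (∫_{−λ}^{λ} (λ − |β|) F(α + β) dβ) dα = ∫_{−2λ}^{2λ} Φ_λ(u) F(c + u) du` with the
tent-smoothed window `Φ_λ(u) = λ² − u²/2 (|u| ≤ λ)`, `(2λ − |u|)²/2 (λ ≤ |u| ≤ 2λ)` — and NOT
`λ² ∫_{c−2λ}^{c+2λ} F(w) dw` as the printed interchange (p0015:L9–L15, at `c = 1`) asserts. Proof: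
`α = c + s`, `β = u − s`, Fubini on `(−λ, λ] × (−2λ, 2λ]`, and `integral_tentWindow`. OUR
CORRECTION of the printed display (E-ah-5); the source's first two equalities are as printed.
[cite: BaluyotGoldstonSuriajayaTurnageButterbaugh2025, §6, proof of Lemma 6 (iii)–(v)] -/
theorem integral_integral_tent_eq {F : ℝ → ℝ} (hF : Continuous F) {lam : ℝ} (hlam : 0 < lam)
    (c : ℝ) :
    ∫ α in (c - lam)..(c + lam), (∫ β in (-lam)..lam, (lam - |β|) * F (α + β)) =
      ∫ u in (-(2 * lam))..(2 * lam),
        (if |u| ≤ lam then lam ^ 2 - u ^ 2 / 2 else (2 * lam - |u|) ^ 2 / 2) * F (c + u) := by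
  -- (A) `α = c + s`
  have hA : ∫ α in (c - lam)..(c + lam), (∫ β in (-lam)..lam, (lam - |β|) * F (α + β)) =
      ∫ s in (-lam)..lam, (∫ β in (-lam)..lam, (lam - |β|) * F (c + s + β)) := by
    rw [show c - lam = c + -lam by ring,
      ← intervalIntegral.integral_comp_add_left
        (fun α ↦ ∫ β in (-lam)..lam, (lam - |β|) * F (α + β)) c]
  -- (B) `β = u − s`, truncated tent on the fixed range `[−2λ, 2λ]`
  have hB : ∫ s in (-lam)..lam, (∫ β in (-lam)..lam, (lam - |β|) * F (c + s + β)) =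
      ∫ s in (-lam)..lam,
        ∫ u in (-(2 * lam))..(2 * lam), max (lam - |u - s|) 0 * F (c + u) := by
    refine intervalIntegral.integral_congr fun s hs ↦ ?_
    rw [Set.uIcc_of_le (by linarith)] at hs
    exact integral_tent_shift hF hlam c (abs_le.mpr ⟨hs.1, hs.2⟩)
  -- (C) Fubini on `(−λ, λ] × (−2λ, 2λ]` (continuous integrand on a compact box)
  have hC : ∫ s in (-lam)..lam,
        ∫ u in (-(2 * lam))..(2 * lam), max (lam - |u - s|) 0 * F (c + u) =
      ∫ u in (-(2 * lam))..(2 * lam),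
        ∫ s in (-lam)..lam, max (lam - |u - s|) 0 * F (c + u) := by
    simp only [intervalIntegral.integral_of_le (by linarith : -lam ≤ lam),
      intervalIntegral.integral_of_le (by linarith : -(2 * lam) ≤ 2 * lam)]
    apply MeasureTheory.integral_integral_swap
    rw [Measure.prod_restrict]
    have hK : IsCompact (Icc (-lam) lam ×ˢ Icc (-(2 * lam)) (2 * lam)) :=
      isCompact_Icc.prod isCompact_Icc
    have hcont : Continuous fun p : ℝ × ℝ ↦ max (lam - |p.2 - p.1|) 0 * F (c + p.2) :=
      ((continuous_const.sub ((continuous_snd.sub continuous_fst).abs)).max continuous_const).mul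
        (hF.comp (continuous_const.add continuous_snd))
    exact (hcont.continuousOn.integrableOn_compact hK).mono_set
      (Set.prod_mono Ioc_subset_Icc_self Ioc_subset_Icc_self)
  -- (D) the inner integral in closed form
  have hD : ∫ u in (-(2 * lam))..(2 * lam),
        ∫ s in (-lam)..lam, max (lam - |u - s|) 0 * F (c + u) =
      ∫ u in (-(2 * lam))..(2 * lam),
        (if |u| ≤ lam then lam ^ 2 - u ^ 2 / 2 else (2 * lam - |u|) ^ 2 / 2) * F (c + u) := by
    refine intervalIntegral.integral_congr fun u hu ↦ ?_
    rw [Set.uIcc_of_le (by linarith)] at hu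
    show (∫ s in (-lam)..lam, max (lam - |u - s|) 0 * F (c + u)) = _
    rw [intervalIntegral.integral_mul_const,
      integral_tentWindow hlam (abs_le.mpr ⟨by linarith [hu.1], hu.2⟩)]
  rw [hA, hB, hC, hD]

/-- **E-ah-5 for the Heath-Brown average of Montgomery's form factor**:
`λ² ∫_{c−λ}^{c+λ} G_λ(α, T) dα = ∫_{−2λ}^{2λ} Φ_λ(u) F(c + u, T) du` (any `T`, any centre `c`,
`λ > 0`; `G_λ = AH.heathBrownG`, `F = montgomeryFormFactor`). At `c = 1` this replaces the printed
`= λ² ∫_{1−2λ}^{1+2λ} F` (p0015:L9–L15). OUR CORRECTION (E-ah-5).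
[cite: BaluyotGoldstonSuriajayaTurnageButterbaugh2025, §6, proof of Lemma 6 (iii)–(v)] -/
theorem sq_mul_integral_heathBrownG {lam : ℝ} (hlam : 0 < lam) (c T : ℝ) :
    lam ^ 2 * ∫ α in (c - lam)..(c + lam), heathBrownG lam α T =
      ∫ u in (-(2 * lam))..(2 * lam),
        (if |u| ≤ lam then lam ^ 2 - u ^ 2 / 2 else (2 * lam - |u|) ^ 2 / 2) *
          montgomeryFormFactor (c + u) T := by
  rw [← intervalIntegral.integral_const_mul]
  have h : (fun α ↦ lam ^ 2 * heathBrownG lam α T) =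
      fun α ↦ ∫ β in (-lam)..lam, (lam - |β|) * montgomeryFormFactor (α + β) T := by
    ext α
    exact sq_mul_heathBrownG hlam.ne' α T
  rw [h]
  exact integral_integral_tent_eq (F := fun x ↦ montgomeryFormFactor x T)
    (RudnickSarnak.continuous_montgomeryFormFactor T) hlam c

/-- **Mass of the smoothed window**: `∫_{−2λ}^{2λ} Φ_λ(u) du = 2λ³`, i.e. `φ_λ = Φ_λ/λ²` has mass
`2λ` — not the `4λ` of the printed flat window `[1−2λ, 1+2λ]`. OUR COMPUTATION (E-ah-5).
[cite: BaluyotGoldstonSuriajayaTurnageButterbaugh2025, §6, proof of Lemma 6 (iii)–(v)] -/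
theorem integral_tentWindow_weight {lam : ℝ} (hlam : 0 < lam) :
    ∫ u in (-(2 * lam))..(2 * lam),
      (if |u| ≤ lam then lam ^ 2 - u ^ 2 / 2 else (2 * lam - |u|) ^ 2 / 2) = 2 * lam ^ 3 := by
  have h := integral_integral_tent_eq (F := fun _ ↦ (1 : ℝ)) continuous_const hlam 0
  simp only [intervalIntegral.integral_const, smul_eq_mul, mul_one] at h
  rw [integral_tent hlam] at h
  have : (0 + lam - (0 - lam)) * lam ^ 2 = 2 * lam ^ 3 := by ring
  linarith

/-- **Constant test functions** (the `F ≡ 1` check of E-ah-5): for `F ≡ a`,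
`∫_{c−λ}^{c+λ} (λ⁻² ∫_{−λ}^{λ} (λ − |β|) a dβ) dα = 2λa` while the printed right-hand side is
`∫_{c−2λ}^{c+2λ} a = 4λa`. [cite: BaluyotGoldstonSuriajayaTurnageButterbaugh2025, §6, proof of
Lemma 6 (iii)–(v)] -/
theorem integral_integral_tent_const {lam : ℝ} (hlam : 0 < lam) (c a : ℝ) :
    ∫ _α in (c - lam)..(c + lam), (1 / lam ^ 2 * ∫ β in (-lam)..lam, (lam - |β|) * a) =
        2 * lam * a ∧
      ∫ _w in (c - 2 * lam)..(c + 2 * lam), a = 4 * lam * a := by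
  have hin : ∫ β in (-lam)..lam, (lam - |β|) * a = lam ^ 2 * a := by
    rw [intervalIntegral.integral_mul_const, integral_tent hlam]
  refine ⟨?_, ?_⟩
  · rw [hin, intervalIntegral.integral_const, smul_eq_mul]
    field_simp
    ring
  · rw [intervalIntegral.integral_const, smul_eq_mul]
    ring

/-- **E-ah-5 certificate.** The printed evaluation (p0015:L9–L15), read as the identity
`∫_{1−λ}^{1+λ} λ⁻² ∫_{−λ}^{λ} (λ − |β|) F(α + β) dβ dα = ∫_{1−2λ}^{1+2λ} F(w) dw` for all continuous
`F` and `0 < λ ≤ 1/4`, is FALSE (`F ≡ 1`, `λ = 1/4`: `1/2 ≠ 1`). This refutes the printed PROOF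
step, not the printed statements Lemma 6 (iii)/(v) (E-ah-5 of record: "unsupported as printed").
[cite: BaluyotGoldstonSuriajayaTurnageButterbaugh2025, §6, proof of Lemma 6 (iii)–(v)] -/
theorem bgstb2025_lemma6_printed_display_fails :
    ¬ ∀ F : ℝ → ℝ, Continuous F → ∀ lam : ℝ, 0 < lam → lam ≤ 1 / 4 →
      ∫ α in (1 - lam)..(1 + lam), (1 / lam ^ 2 * ∫ β in (-lam)..lam, (lam - |β|) * F (α + β)) =
        ∫ w in (1 - 2 * lam)..(1 + 2 * lam), F w := by
  intro h
  have h1 : ∫ α in (1 - 1 / 4 : ℝ)..(1 + 1 / 4),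
      (1 / (1 / 4 : ℝ) ^ 2 * ∫ β in (-(1 / 4 : ℝ))..(1 / 4), ((1 / 4 : ℝ) - |β|) * 1) =
        ∫ w in (1 - 2 * (1 / 4) : ℝ)..(1 + 2 * (1 / 4)), (1 : ℝ) :=
    h (fun _ ↦ 1) continuous_const (1 / 4) (by norm_num) le_rfl
  have h2 := integral_integral_tent_const (by norm_num : (0 : ℝ) < 1 / 4) 1 1
  rw [h2.1, h2.2] at h1
  norm_num at h1

/-- The integrand `Φ_λ(u) F(c + u)` with `F ≥ 0` continuous: `λ²/2 ∫_{c−λ}^{c+λ} F ≤ ∫ Φ_λ F(c + ·)`. [folklore] -/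
private theorem sq_half_mul_integral_le {F : ℝ → ℝ} (hF : Continuous F) (hF0 : ∀ x, 0 ≤ F x)
    {lam : ℝ} (hlam : 0 < lam) (c : ℝ) :
    lam ^ 2 / 2 * ∫ w in (c - lam)..(c + lam), F w ≤
      ∫ u in (-(2 * lam))..(2 * lam),
        (if |u| ≤ lam then lam ^ 2 - u ^ 2 / 2 else (2 * lam - |u|) ^ 2 / 2) * F (c + u) := by
  have hFc : Continuous fun u ↦ F (c + u) := hF.comp (continuous_const.add continuous_id)
  have hii : ∀ a b : ℝ, IntervalIntegrable (fun u : ℝ ↦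
      (if |u| ≤ lam then lam ^ 2 - u ^ 2 / 2 else (2 * lam - |u|) ^ 2 / 2) * F (c + u))
        volume a b :=
    fun a b ↦ ((continuous_tentWindow lam).mul hFc).intervalIntegrable a b
  have hnn : ∀ a b : ℝ, a ≤ b → -(2 * lam) ≤ a → b ≤ 2 * lam →
      0 ≤ ∫ u in a..b,
        (if |u| ≤ lam then lam ^ 2 - u ^ 2 / 2 else (2 * lam - |u|) ^ 2 / 2) * F (c + u) := by
    intro a b hab ha hb
    refine intervalIntegral.integral_nonneg hab fun u hu ↦ ?_
    exact mul_nonneg (tentWindow_bounds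
      (abs_le.mpr ⟨by linarith [hu.1], by linarith [hu.2]⟩)).1 (hF0 _)
  rw [← intervalIntegral.integral_add_adjacent_intervals (hii (-(2 * lam)) (-lam))
      (hii (-lam) (2 * lam)),
    ← intervalIntegral.integral_add_adjacent_intervals (hii (-lam) lam) (hii lam (2 * lam))]
  have h1 := hnn (-(2 * lam)) (-lam) (by linarith) le_rfl (by linarith)
  have h3 := hnn lam (2 * lam) (by linarith) (by linarith) le_rfl
  have h2 : lam ^ 2 / 2 * ∫ w in (c - lam)..(c + lam), F w ≤
      ∫ u in (-lam)..lam,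
        (if |u| ≤ lam then lam ^ 2 - u ^ 2 / 2 else (2 * lam - |u|) ^ 2 / 2) * F (c + u) := by
    have hw : ∫ w in (c - lam)..(c + lam), F w = ∫ u in (-lam)..lam, F (c + u) := by
      rw [intervalIntegral.integral_comp_add_left F c, sub_eq_add_neg]
    rw [hw, ← intervalIntegral.integral_const_mul]
    refine intervalIntegral.integral_mono_on (by linarith)
      ((hFc.const_mul _).intervalIntegrable _ _) (hii _ _) fun u hu ↦ ?_
    have hu' : |u| ≤ lam := abs_le.mpr ⟨hu.1, hu.2⟩
    exact mul_le_mul_of_nonneg_right ((tentWindow_bounds (by linarith)).2.2 hu') (hF0 _)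
  linarith

/-- **What survives of the printed display, for `F ≥ 0` (`T > 1`)**: since `0 ≤ Φ_λ ≤ λ²`, the
printed evaluation holds as the INEQUALITY `∫_{c−λ}^{c+λ} G_λ(α, T) dα ≤ ∫_{c−2λ}^{c+2λ} F(w, T) dw`
(so (Cor5-G(1)ave) bounds the flat window from BELOW only). OUR CORRECTION (E-ah-5).
[cite: BaluyotGoldstonSuriajayaTurnageButterbaugh2025, §6, proof of Lemma 6 (iii)–(v)] -/
theorem integral_heathBrownG_le_window {lam : ℝ} (hlam : 0 < lam) {T : ℝ} (hT : 1 < T) (c : ℝ) :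
    ∫ α in (c - lam)..(c + lam), heathBrownG lam α T ≤
      ∫ w in (c - 2 * lam)..(c + 2 * lam), montgomeryFormFactor w T := by
  have hFc : Continuous fun u ↦ montgomeryFormFactor (c + u) T :=
    (RudnickSarnak.continuous_montgomeryFormFactor T).comp (continuous_const.add continuous_id)
  have h := sq_mul_integral_heathBrownG hlam c T
  have hw : ∫ w in (c - 2 * lam)..(c + 2 * lam), montgomeryFormFactor w T =
      ∫ u in (-(2 * lam))..(2 * lam), montgomeryFormFactor (c + u) T := by
    rw [intervalIntegral.integral_comp_add_left (fun w ↦ montgomeryFormFactor w T) c,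
      sub_eq_add_neg]
  have hle : ∫ u in (-(2 * lam))..(2 * lam),
      (if |u| ≤ lam then lam ^ 2 - u ^ 2 / 2 else (2 * lam - |u|) ^ 2 / 2) *
        montgomeryFormFactor (c + u) T ≤
      ∫ u in (-(2 * lam))..(2 * lam), lam ^ 2 * montgomeryFormFactor (c + u) T := by
    refine intervalIntegral.integral_mono_on (by linarith)
      (((continuous_tentWindow lam).mul hFc).intervalIntegrable _ _)
      ((hFc.const_mul _).intervalIntegrable _ _) fun u hu ↦ ?_
    exact mul_le_mul_of_nonneg_right
      (tentWindow_bounds (abs_le.mpr ⟨by linarith [hu.1], hu.2⟩)).2.1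
      (Montgomery.montgomeryFormFactor_nonneg _ hT)
  rw [intervalIntegral.integral_const_mul, ← h, ← hw] at hle
  exact le_of_mul_le_mul_left hle (pow_pos hlam 2)

/-- For `T > 1`: `½ ∫_{c−λ}^{c+λ} F(w, T) dw ≤ ∫_{c−λ}^{c+λ} G_λ(α, T) dα` (since `Φ_λ ≥ λ²/2` on
`|u| ≤ λ` and `Φ_λ F ≥ 0`). OUR CORRECTION (E-ah-5).
[cite: BaluyotGoldstonSuriajayaTurnageButterbaugh2025, §6, proof of Lemma 6 (iii)–(v)] -/
theorem half_integral_window_le_integral_heathBrownG {lam : ℝ} (hlam : 0 < lam) {T : ℝ}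
    (hT : 1 < T) (c : ℝ) :
    1 / 2 * ∫ w in (c - lam)..(c + lam), montgomeryFormFactor w T ≤
      ∫ α in (c - lam)..(c + lam), heathBrownG lam α T := by
  have h := sq_mul_integral_heathBrownG hlam c T
  have hge := sq_half_mul_integral_le (F := fun x ↦ montgomeryFormFactor x T)
    (RudnickSarnak.continuous_montgomeryFormFactor T)
    (fun x ↦ Montgomery.montgomeryFormFactor_nonneg x hT) hlam c
  have hge' := hge.trans_eq h.symm
  refine le_of_mul_le_mul_left ?_ (pow_pos hlam 2)
  have e : lam ^ 2 * (1 / 2 * ∫ w in (c - lam)..(c + lam), montgomeryFormFactor w T) =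
      lam ^ 2 / 2 * ∫ w in (c - lam)..(c + lam), montgomeryFormFactor w T := by ring
  rw [e]
  exact hge'

end AH

/-! ## §5. Lemma 6 (iii) at `K = 1`: the surviving LOWER bound, modulo Corollary 5 -/

/-- **BGSTB 2025, Lemma 6 (iii) at `K = 1` — lower half, modulo Corollary 5.** Printed (iii):
"`∫_{K−λ}^{K+λ} F(β) dβ = 2(P_0 − 1) + O(λ) + O(E_G(λ², K)) + O(1/(λ⁴ √log T))`"; its printed
proof at `K = 1` (p0015:L9–L19) evaluates `∫_{1−λ}^{1+λ} G_λ` as the flat window `∫_{1−2λ}^{1+2λ} F`,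
which is false (E-ah-5, §4). What the paper's own inputs DO give (OUR READING, not a quotation):
since `F ≥ 0` and `Φ_μ ≤ μ²`, `∫_{1−μ}^{1+μ} G_μ ≤ ∫_{1−2μ}^{1+2μ} F`
(`AH.integral_heathBrownG_le_window`), so Corollary 5 at `μ = λ/2` bounds the flat window of
radius `λ ≤ 1/2` from BELOW with the printed `λ`-rate:
`∫_{1−λ}^{1+λ} F ≥ 2(P_0 − 1) − C (λ + E_G(λ/2, 1) + 1/(λ² √log T))` for all large `T`. The
matching upper bound is not obtained this way and is not claimed. Conditional on the claim
`bgstb2025_corollary5` (consumed as a hypothesis; RH is its antecedent).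
[cite: BaluyotGoldstonSuriajayaTurnageButterbaugh2025, Lemma 6 (iii) and Corollary 5, §6] -/
theorem bgstb2025_lemma6_iii_lower_of_corollary5 (h5 : bgstb2025_corollary5)
    (hRH : RiemannHypothesis) :
    ∀ M : ℝ, 0 < M → ∀ R : ℝ → ℝ, AH.IsPairsRate M R → ∀ δ : ℝ, 0 < δ → δ ≤ 1 / 2 →
      ∃ C : ℝ, ∀ᶠ T : ℝ in atTop, ∀ lam : ℝ, 0 < lam → lam ≤ 1 / 2 →
        2 * (AH.binDensity 0 T M δ - 1) -
            C * (lam + AH.errG M (R T) T (lam / 2) 1 + 1 / (lam ^ 2 * Real.sqrt (Real.log T))) ≤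
          ∫ β in (1 - lam)..(1 + lam), montgomeryFormFactor β T := by
  intro M hM R hR δ hδ hδ2
  obtain ⟨C, hC⟩ := h5 hRH M hM R hR δ hδ hδ2
  refine ⟨4 * |C|, ?_⟩
  filter_upwards [hC, eventually_gt_atTop (1 : ℝ)] with T hT hT1 lam hlam hlam2
  have hlog : 0 < Real.log T := Real.log_pos hT1
  have hsq : 0 < Real.sqrt (Real.log T) := Real.sqrt_pos.mpr hlog
  have hRT : 0 < R T := hR.1 T
  have hμ := hT (lam / 2) (by linarith) (by linarith)
  have hwin := AH.integral_heathBrownG_le_window (half_pos hlam) hT1 1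
  rw [show 2 * (lam / 2) = lam by ring] at hwin
  have hE : 0 ≤ AH.errG M (R T) T (lam / 2) 1 := by
    simp only [AH.errG]
    positivity
  have hX : 0 ≤ 1 / ((lam / 2) ^ 2 * Real.sqrt (Real.log T)) := by positivity
  have hS : 0 ≤ lam / 2 + AH.errG M (R T) T (lam / 2) 1 +
      1 / ((lam / 2) ^ 2 * Real.sqrt (Real.log T)) :=
    add_nonneg (add_nonneg (by linarith) hE) hX
  have h1 : C * (lam / 2 + AH.errG M (R T) T (lam / 2) 1 +
        1 / ((lam / 2) ^ 2 * Real.sqrt (Real.log T))) ≤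
      |C| * (lam / 2 + AH.errG M (R T) T (lam / 2) 1 +
        1 / ((lam / 2) ^ 2 * Real.sqrt (Real.log T))) :=
    mul_le_mul_of_nonneg_right (le_abs_self C) hS
  have h2 : |C| * (lam / 2 + AH.errG M (R T) T (lam / 2) 1 +
        1 / ((lam / 2) ^ 2 * Real.sqrt (Real.log T))) ≤
      4 * |C| * (lam + AH.errG M (R T) T (lam / 2) 1 +
        1 / (lam ^ 2 * Real.sqrt (Real.log T))) := by
    have e : 1 / ((lam / 2) ^ 2 * Real.sqrt (Real.log T)) =
        4 * (1 / (lam ^ 2 * Real.sqrt (Real.log T))) := by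
      field_simp
      ring
    rw [e]
    have hA : 0 ≤ |C| := abs_nonneg C
    have p1 := mul_nonneg hA hE
    have p2 := mul_nonneg hA hlam.le
    have p3 : 0 ≤ |C| * (1 / (lam ^ 2 * Real.sqrt (Real.log T))) := by positivity
    linarith
  have h3 := (abs_le.mp (hμ.trans h1)).1
  linarith

/-- **BGSTB 2025, Lemma 6 (iii) at `K = 1`, lower half — proved outright from RH** (for every
AH-Pairs datum `(M, R)` and bin half-width `δ`): `bgstb2025_lemma6_iii_lower_of_corollary5` fed with
the tree's discharge `bgstb2025_corollary5_holds` (`AlternativeHypothesisFormFactorRHProofs`). The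
upper half of (iii) with the printed rate remains unsupported (E-ah-5).
[cite: BaluyotGoldstonSuriajayaTurnageButterbaugh2025, Lemma 6 (iii) and Corollary 5, §6] -/
theorem bgstb2025_lemma6_iii_lower (hRH : RiemannHypothesis) :
    ∀ M : ℝ, 0 < M → ∀ R : ℝ → ℝ, AH.IsPairsRate M R → ∀ δ : ℝ, 0 < δ → δ ≤ 1 / 2 →
      ∃ C : ℝ, ∀ᶠ T : ℝ in atTop, ∀ lam : ℝ, 0 < lam → lam ≤ 1 / 2 →
        2 * (AH.binDensity 0 T M δ - 1) -
            C * (lam + AH.errG M (R T) T (lam / 2) 1 + 1 / (lam ^ 2 * Real.sqrt (Real.log T))) ≤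
          ∫ β in (1 - lam)..(1 + lam), montgomeryFormFactor β T :=
  bgstb2025_lemma6_iii_lower_of_corollary5 bgstb2025_corollary5_holds hRH

/-! ## §6. The sound two-sided form of Lemma 6 (iii) for every odd `K` (tent sandwich)

OUR REPLACEMENT for the printed route of (iii)/(v) (E-ah-5): the flat window `1_{[−λ,λ]}` is
minorised by `Φ_{λ/2}/(λ/2)²·` (support `[−λ, λ]`, `Φ ≤ (λ/2)²`) and majorised by
`Φ_μ/(μ² − λ²/2)` for any `μ ≥ λ` (`Φ_μ ≥ μ² − λ²/2` on `[−λ, λ]`), so that Corollary 5 (proved in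
the tree) and the `2ℤ`-periodicity of `G_μ` up to `O(E_G)` (Lemma 5 (iv), proved in the tree) give,
for every odd `K`, `0 < λ ≤ μ ≤ 1/4` and all large `T`,
`2(P_0 − 1) − C(λ + E_G(λ/2, K) + 1/(λ² √log T)) ≤ ∫_{K−λ}^{K+λ} F
  ≤ (1 + λ²/μ²)(2(P_0 − 1) + C(μ + E_G(μ, K) + 1/(μ² √log T)))`
— no `η = λ²` step, hence no `λ⁻⁴`/`E_G(λ², K)`; the choice `μ = λ^{2/3}` yields the two-sided
`o(1)`-form of (iii) (rate `λ^{2/3}` in place of the printed `λ`). -/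

namespace AH

/-- Tent majorant of the flat window: for continuous `F ≥ 0` and `0 < λ ≤ μ`,
`(μ² − λ²/2) ∫_{c−λ}^{c+λ} F ≤ ∫_{−2μ}^{2μ} Φ_μ(u) F(c + u) du` (`Φ_μ(u) = μ² − u²/2 ≥ μ² − λ²/2` on
`|u| ≤ λ`, `Φ_μ F ≥ 0` elsewhere). [folklore] -/
private theorem sq_sub_mul_integral_le {F : ℝ → ℝ} (hF : Continuous F) (hF0 : ∀ x, 0 ≤ F x)
    {lam mu : ℝ} (hlam : 0 < lam) (hlm : lam ≤ mu) (c : ℝ) :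
    (mu ^ 2 - lam ^ 2 / 2) * ∫ w in (c - lam)..(c + lam), F w ≤
      ∫ u in (-(2 * mu))..(2 * mu),
        (if |u| ≤ mu then mu ^ 2 - u ^ 2 / 2 else (2 * mu - |u|) ^ 2 / 2) * F (c + u) := by
  have hmu : 0 < mu := lt_of_lt_of_le hlam hlm
  have hFc : Continuous fun u ↦ F (c + u) := hF.comp (continuous_const.add continuous_id)
  have hii : ∀ a b : ℝ, IntervalIntegrable (fun u : ℝ ↦
      (if |u| ≤ mu then mu ^ 2 - u ^ 2 / 2 else (2 * mu - |u|) ^ 2 / 2) * F (c + u))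
        volume a b :=
    fun a b ↦ ((continuous_tentWindow mu).mul hFc).intervalIntegrable a b
  have hnn : ∀ a b : ℝ, a ≤ b → -(2 * mu) ≤ a → b ≤ 2 * mu →
      0 ≤ ∫ u in a..b,
        (if |u| ≤ mu then mu ^ 2 - u ^ 2 / 2 else (2 * mu - |u|) ^ 2 / 2) * F (c + u) := by
    intro a b hab ha hb
    refine intervalIntegral.integral_nonneg hab fun u hu ↦ ?_
    exact mul_nonneg (tentWindow_bounds
      (abs_le.mpr ⟨by linarith [hu.1], by linarith [hu.2]⟩)).1 (hF0 _)
  rw [← intervalIntegral.integral_add_adjacent_intervals (hii (-(2 * mu)) (-lam))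
      (hii (-lam) (2 * mu)),
    ← intervalIntegral.integral_add_adjacent_intervals (hii (-lam) lam) (hii lam (2 * mu))]
  have h1 := hnn (-(2 * mu)) (-lam) (by linarith) le_rfl (by linarith)
  have h3 := hnn lam (2 * mu) (by linarith) (by linarith) le_rfl
  have h2 : (mu ^ 2 - lam ^ 2 / 2) * ∫ w in (c - lam)..(c + lam), F w ≤
      ∫ u in (-lam)..lam,
        (if |u| ≤ mu then mu ^ 2 - u ^ 2 / 2 else (2 * mu - |u|) ^ 2 / 2) * F (c + u) := by
    have hw : ∫ w in (c - lam)..(c + lam), F w = ∫ u in (-lam)..lam, F (c + u) := by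
      rw [intervalIntegral.integral_comp_add_left F c, sub_eq_add_neg]
    rw [hw, ← intervalIntegral.integral_const_mul]
    refine intervalIntegral.integral_mono_on (by linarith)
      ((hFc.const_mul _).intervalIntegrable _ _) (hii _ _) fun u hu ↦ ?_
    have hu' : |u| ≤ lam := abs_le.mpr ⟨hu.1, hu.2⟩
    have hΦ : (if |u| ≤ mu then mu ^ 2 - u ^ 2 / 2 else (2 * mu - |u|) ^ 2 / 2) =
        mu ^ 2 - u ^ 2 / 2 := if_pos (hu'.trans hlm)
    rw [hΦ]
    refine mul_le_mul_of_nonneg_right ?_ (hF0 _)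
    have : u ^ 2 ≤ lam ^ 2 := by
      rw [← sq_abs u]
      exact pow_le_pow_left₀ (abs_nonneg u) hu' 2
    linarith
  linarith

/-- **Tent majorant, `G_μ` form** (OUR REPLACEMENT for the printed flat-window evaluation, E-ah-5):
for `T > 1` and `0 < λ ≤ μ`, `(μ² − λ²/2) ∫_{c−λ}^{c+λ} F(w, T) dw ≤ μ² ∫_{c−μ}^{c+μ} G_μ(α, T) dα`.
[cite: BaluyotGoldstonSuriajayaTurnageButterbaugh2025, §6, proof of Lemma 6 (iii)–(v)] -/
theorem sq_sub_mul_integral_window_le {lam mu : ℝ} (hlam : 0 < lam) (hlm : lam ≤ mu) {T : ℝ}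
    (hT : 1 < T) (c : ℝ) :
    (mu ^ 2 - lam ^ 2 / 2) * ∫ w in (c - lam)..(c + lam), montgomeryFormFactor w T ≤
      mu ^ 2 * ∫ α in (c - mu)..(c + mu), heathBrownG mu α T := by
  have h := sq_mul_integral_heathBrownG (lt_of_lt_of_le hlam hlm) c T
  have hle := sq_sub_mul_integral_le (F := fun x ↦ montgomeryFormFactor x T)
    (RudnickSarnak.continuous_montgomeryFormFactor T)
    (fun x ↦ Montgomery.montgomeryFormFactor_nonneg x hT) hlam hlm c
  exact hle.trans_eq h.symm

/-- **Transport `1 ↦ K = 2L + 1` of the averaged `G_μ`** (from Lemma 5 (iv), proved in the tree as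
`AH.heathBrownG_add_two_mul_sub_le`): for all large `T`, all `0 < μ ≤ 1/4` and `L ∈ ℤ`,
`|∫_{K−μ}^{K+μ} G_μ − ∫_{1−μ}^{1+μ} G_μ| ≤ C μ E_G(μ, K)`, `K = 2L + 1` (pointwise
`G_μ(α + 2L) = G_μ(α) + O(E_G(μ, |α| + 2|L|))` on `|α| ≤ 5/4`, and
`E_G(μ, |α| + 2|L|) ≤ (13/4) E_G(μ, K)`). Printed use: "By Lemma 5 (iv),
`G_λ(K) = G_λ(2L+1) = G_λ(1) + O(E_G(λ, K))`" (p0015:L50–L52).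
[cite: BaluyotGoldstonSuriajayaTurnageButterbaugh2025, Lemma 5 (iv) and §6] -/
theorem exists_abs_integral_heathBrownG_odd_sub_le (hRH : RiemannHypothesis) {M : ℝ} (hM : 0 < M)
    {R : ℝ → ℝ} (hR : IsPairsRate M R) {δ : ℝ} (hδ : 0 < δ) (hδ2 : δ ≤ 1 / 2) :
    ∃ C : ℝ, ∀ᶠ T : ℝ in atTop, ∀ mu : ℝ, 0 < mu → mu ≤ 1 / 4 → ∀ L : ℤ,
      |(∫ α in ((2 * L + 1 : ℝ) - mu)..((2 * L + 1 : ℝ) + mu), heathBrownG mu α T) -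
          ∫ α in (1 - mu)..(1 + mu), heathBrownG mu α T| ≤
        C * mu * errG M (R T) T mu (2 * L + 1) := by
  obtain ⟨C₂, hC₂⟩ := heathBrownG_add_two_mul_sub_le hRH hM hR hδ hδ2
  have hR0 : ∀ T, 0 < R T := hR.1
  refine ⟨13 / 2 * |C₂|, ?_⟩
  filter_upwards [hC₂, eventually_gt_atTop (1 : ℝ)] with T hT hT1 mu hmu hmu4 L
  have hlog : 0 < Real.log T := Real.log_pos hT1
  have hRT : 0 < R T := hR0 T
  have hGc : Continuous fun α : ℝ ↦ heathBrownG mu α T := continuous_heathBrownG mu T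
  have hGc' : Continuous fun α : ℝ ↦ heathBrownG mu (α + 2 * L) T :=
    hGc.comp (continuous_id.add continuous_const)
  -- shift the window at `K` back to the window at `1`
  have hshift : ∫ α in ((2 * L + 1 : ℝ) - mu)..((2 * L + 1 : ℝ) + mu), heathBrownG mu α T =
      ∫ α in (1 - mu)..(1 + mu), heathBrownG mu (α + 2 * L) T := by
    rw [intervalIntegral.integral_comp_add_right (fun α ↦ heathBrownG mu α T) (2 * (L : ℝ)),
      show (1 : ℝ) - mu + 2 * L = 2 * L + 1 - mu by ring,
      show (1 : ℝ) + mu + 2 * L = 2 * L + 1 + mu by ring]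
  rw [hshift, ← intervalIntegral.integral_sub (hGc'.intervalIntegrable _ _)
    (hGc.intervalIntegrable _ _)]
  -- pointwise bound on the window `|α| ≤ 5/4`
  have hK : 2 * |(L : ℝ)| ≤ |(2 * L + 1 : ℝ)| + 1 := by
    have h := abs_sub (2 * (L : ℝ) + 1) 1
    rw [add_sub_cancel_right, abs_mul, abs_two, abs_one] at h
    exact h
  have hbound : ∀ α ∈ Set.uIoc (1 - mu) (1 + mu),
      ‖heathBrownG mu (α + 2 * L) T - heathBrownG mu α T‖ ≤
        13 / 4 * |C₂| * errG M (R T) T mu (2 * L + 1) := by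
    intro α hα
    rw [Set.uIoc_of_le (by linarith)] at hα
    have hα' : |α| ≤ 5 / 4 := abs_le.mpr ⟨by linarith [hα.1], by linarith [hα.2]⟩
    have h1 := hT mu hmu (by linarith) α L
    have hE0 : 0 ≤ errG M (R T) T mu (|α| + 2 * |(L : ℝ)|) := by
      simp only [errG]
      positivity
    have h2 : C₂ * errG M (R T) T mu (|α| + 2 * |(L : ℝ)|) ≤
        |C₂| * errG M (R T) T mu (|α| + 2 * |(L : ℝ)|) :=
      mul_le_mul_of_nonneg_right (le_abs_self _) hE0
    have h3 : errG M (R T) T mu (|α| + 2 * |(L : ℝ)|) ≤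
        13 / 4 * errG M (R T) T mu (2 * L + 1) := by
      simp only [errG]
      rw [abs_of_nonneg (by positivity : (0 : ℝ) ≤ |α| + 2 * |(L : ℝ)|)]
      have t1 : 1 / (mu ^ 2 * M) ≤ 13 / 4 * (1 / (mu ^ 2 * M)) := by
        have : 0 ≤ 1 / (mu ^ 2 * M) := by positivity
        linarith
      have t2 : (|α| + 2 * |(L : ℝ)| + 1) * M ^ 2 * R T ≤
          13 / 4 * ((|(2 * L + 1 : ℝ)| + 1) * M ^ 2 * R T) := by
        have hMR : 0 ≤ M ^ 2 * R T := by positivity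
        have hcoef : |α| + 2 * |(L : ℝ)| + 1 ≤ 13 / 4 * (|(2 * L + 1 : ℝ)| + 1) := by
          have : 0 ≤ |(2 * L + 1 : ℝ)| := abs_nonneg _
          linarith
        have := mul_le_mul_of_nonneg_right hcoef hMR
        linarith [this]
      have t3 : 1 / Real.log T ≤ 13 / 4 * (1 / Real.log T) := by
        have : 0 ≤ 1 / Real.log T := by positivity
        linarith
      linarith
    calc ‖heathBrownG mu (α + 2 * L) T - heathBrownG mu α T‖
        = |heathBrownG mu (α + 2 * L) T - heathBrownG mu α T| := Real.norm_eq_abs _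
      _ ≤ C₂ * errG M (R T) T mu (|α| + 2 * |(L : ℝ)|) := h1
      _ ≤ |C₂| * errG M (R T) T mu (|α| + 2 * |(L : ℝ)|) := h2
      _ ≤ |C₂| * (13 / 4 * errG M (R T) T mu (2 * L + 1)) :=
          mul_le_mul_of_nonneg_left h3 (abs_nonneg _)
      _ = 13 / 4 * |C₂| * errG M (R T) T mu (2 * L + 1) := by ring
  have h := intervalIntegral.norm_integral_le_of_norm_le_const hbound
  rw [Real.norm_eq_abs, show (1 : ℝ) + mu - (1 - mu) = 2 * mu by ring,
    abs_of_pos (by linarith : (0 : ℝ) < 2 * mu)] at h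
  calc |∫ α in (1 - mu)..(1 + mu), (heathBrownG mu (α + 2 * L) T - heathBrownG mu α T)|
      ≤ 13 / 4 * |C₂| * errG M (R T) T mu (2 * L + 1) * (2 * mu) := h
    _ = 13 / 2 * |C₂| * mu * errG M (R T) T mu (2 * L + 1) := by ring

end AH

/-- **Lemma 6 (iii), LOWER half, every odd `K` — proved from RH.** OURS: a sound replacement, NOT
the printed (iii) (whose printed proof is invalid, E-ah-5, §4): for every AH-Pairs datum `(M, R)` and bin half-width `δ` there is `C` with, for all
large `T`, all `0 < λ ≤ 1/2` and all odd `K`,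
`2(P_0 − 1) − C(λ + E_G(λ/2, K) + 1/(λ² √log T)) ≤ ∫_{K−λ}^{K+λ} F(β, T) dβ`.
Inputs: Corollary 5 at `λ/2` (tree `bgstb2025_corollary5_holds`), transport `1 ↦ K`
(`AH.exists_abs_integral_heathBrownG_odd_sub_le`), and the minorant
`∫_{K−λ/2}^{K+λ/2} G_{λ/2} ≤ ∫_{K−λ}^{K+λ} F` (`AH.integral_heathBrownG_le_window`). Compare the
printed (iii): "`∫_{K−λ}^{K+λ} F(β) dβ = 2(P_0 − 1) + O(λ) + O(E_G(λ², K)) + O(1/(λ⁴ √log T))`".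
[cite: BaluyotGoldstonSuriajayaTurnageButterbaugh2025, Lemma 6 (iii)] -/
theorem bgstb2025_lemma6_iii_lower_odd (hRH : RiemannHypothesis) :
    ∀ M : ℝ, 0 < M → ∀ R : ℝ → ℝ, AH.IsPairsRate M R → ∀ δ : ℝ, 0 < δ → δ ≤ 1 / 2 →
      ∃ C : ℝ, ∀ᶠ T : ℝ in atTop, ∀ lam : ℝ, 0 < lam → lam ≤ 1 / 2 → ∀ K : ℤ, Odd K →
        2 * (AH.binDensity 0 T M δ - 1) -
            C * (lam + AH.errG M (R T) T (lam / 2) K + 1 / (lam ^ 2 * Real.sqrt (Real.log T))) ≤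
          ∫ β in (K - lam)..(K + lam), montgomeryFormFactor β T := by
  intro M hM R hR δ hδ hδ2
  obtain ⟨C, hC⟩ := bgstb2025_corollary5_holds hRH M hM R hR δ hδ hδ2
  obtain ⟨C₂, hC₂⟩ := AH.exists_abs_integral_heathBrownG_odd_sub_le hRH hM hR hδ hδ2
  refine ⟨4 * |C| + |C₂|, ?_⟩
  filter_upwards [hC, hC₂, eventually_gt_atTop (1 : ℝ)] with T hT hT₂ hT1 lam hlam hlam2 K hK
  obtain ⟨L, rfl⟩ := hK
  push_cast
  have hlog : 0 < Real.log T := Real.log_pos hT1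
  have hsq : 0 < Real.sqrt (Real.log T) := Real.sqrt_pos.mpr hlog
  have hRT : 0 < R T := hR.1 T
  set mu : ℝ := lam / 2 with hmu_def
  have hmu : 0 < mu := by rw [hmu_def]; linarith
  have hmu4 : mu ≤ 1 / 4 := by rw [hmu_def]; linarith
  -- the three inputs
  have h5 := hT mu hmu hmu4
  have htr := hT₂ mu hmu hmu4 L
  have hwin := AH.integral_heathBrownG_le_window hmu hT1 (2 * (L : ℝ) + 1)
  rw [show 2 * mu = lam by rw [hmu_def]; ring] at hwin
  -- bookkeeping of the error terms
  have hK1 : (1 : ℝ) ≤ |(2 * L + 1 : ℝ)| := by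
    have h : (1 : ℤ) ≤ |2 * L + 1| := Int.one_le_abs (by omega)
    have h' := (Int.cast_le (R := ℝ)).mpr h
    push_cast [Int.cast_abs] at h'
    exact h'
  have hEK : 0 ≤ AH.errG M (R T) T mu (2 * L + 1) := by
    simp only [AH.errG]
    positivity
  have hE1 : AH.errG M (R T) T mu 1 ≤ AH.errG M (R T) T mu (2 * L + 1) := by
    simp only [AH.errG, abs_one]
    have hMR : 0 ≤ M ^ 2 * R T := by positivity
    nlinarith
  have hZ : 0 ≤ 1 / (lam ^ 2 * Real.sqrt (Real.log T)) := by positivity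
  have hY : 1 / (mu ^ 2 * Real.sqrt (Real.log T)) = 4 * (1 / (lam ^ 2 * Real.sqrt (Real.log T))) := by
    rw [hmu_def]
    field_simp
    ring
  have hS : 0 ≤ mu + AH.errG M (R T) T mu 1 + 1 / (mu ^ 2 * Real.sqrt (Real.log T)) := by
    have : 0 ≤ AH.errG M (R T) T mu 1 := by
      simp only [AH.errG]
      positivity
    positivity
  -- pass to `|C|`, `|C₂|`
  have h5' : 2 * (AH.binDensity 0 T M δ - 1) -
      |C| * (mu + AH.errG M (R T) T mu 1 + 1 / (mu ^ 2 * Real.sqrt (Real.log T))) ≤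
        ∫ α in (1 - mu)..(1 + mu), AH.heathBrownG mu α T := by
    have := (abs_le.mp (h5.trans (mul_le_mul_of_nonneg_right (le_abs_self C) hS))).1
    linarith
  have htr' : (∫ α in (1 - mu)..(1 + mu), AH.heathBrownG mu α T) - |C₂| * mu *
      AH.errG M (R T) T mu (2 * L + 1) ≤
        ∫ α in ((2 * L + 1 : ℝ) - mu)..((2 * L + 1 : ℝ) + mu), AH.heathBrownG mu α T := by
    have := (abs_le.mp (htr.trans
      (mul_le_mul_of_nonneg_right (mul_le_mul_of_nonneg_right (le_abs_self C₂) hmu.le) hEK))).1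
    linarith
  -- comparison of the error shapes
  have hc1 : mu + AH.errG M (R T) T mu 1 + 1 / (mu ^ 2 * Real.sqrt (Real.log T)) ≤
      4 * (lam + AH.errG M (R T) T mu (2 * L + 1) + 1 / (lam ^ 2 * Real.sqrt (Real.log T))) := by
    rw [hY, hmu_def] at *
    linarith
  have hc2 : mu * AH.errG M (R T) T mu (2 * L + 1) ≤
      lam + AH.errG M (R T) T mu (2 * L + 1) + 1 / (lam ^ 2 * Real.sqrt (Real.log T)) := by
    have := mul_le_mul_of_nonneg_right hmu4 hEK
    linarith
  have p1 := mul_le_mul_of_nonneg_left hc1 (abs_nonneg C)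
  have p2 := mul_le_mul_of_nonneg_left hc2 (abs_nonneg C₂)
  linarith

/-- **Lemma 6 (iii), UPPER half, every odd `K` — proved from RH.** OURS: a sound replacement, NOT
the printed (iii) (whose printed proof is invalid, E-ah-5, §4): for every AH-Pairs datum `(M, R)` and `δ` there is `C` with, for all large `T`, all
`0 < λ ≤ μ ≤ 1/4` and all odd `K`,
`∫_{K−λ}^{K+λ} F(β, T) dβ ≤ (1 + λ²/μ²) (2(P_0 − 1) + C(μ + E_G(μ, K) + 1/(μ² √log T)))`.
Inputs: the tent majorant `(μ² − λ²/2) ∫_{K−λ}^{K+λ} F ≤ μ² ∫_{K−μ}^{K+μ} G_μ`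
(`AH.sq_sub_mul_integral_window_le`), transport `1 ↦ K`, Corollary 5 at `μ`
(`bgstb2025_corollary5_holds`), `G_μ ≥ 0` (`bgstb2025_lemma5_rh_holds`), and
`μ²/(μ² − λ²/2) ≤ 1 + λ²/μ²`. With the lower half: `μ = λ^{2/3}` gives (iii) in two-sided
`o(1)`-form with rate `λ^{2/3}`; the printed rate `O(λ)` is not recovered.
[cite: BaluyotGoldstonSuriajayaTurnageButterbaugh2025, Lemma 6 (iii)] -/
theorem bgstb2025_lemma6_iii_upper_odd (hRH : RiemannHypothesis) :
    ∀ M : ℝ, 0 < M → ∀ R : ℝ → ℝ, AH.IsPairsRate M R → ∀ δ : ℝ, 0 < δ → δ ≤ 1 / 2 →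
      ∃ C : ℝ, ∀ᶠ T : ℝ in atTop, ∀ lam mu : ℝ, 0 < lam → lam ≤ mu → mu ≤ 1 / 4 →
        ∀ K : ℤ, Odd K →
          ∫ β in (K - lam)..(K + lam), montgomeryFormFactor β T ≤
            (1 + lam ^ 2 / mu ^ 2) * (2 * (AH.binDensity 0 T M δ - 1) +
              C * (mu + AH.errG M (R T) T mu K + 1 / (mu ^ 2 * Real.sqrt (Real.log T)))) := by
  intro M hM R hR δ hδ hδ2
  obtain ⟨C, hC⟩ := bgstb2025_corollary5_holds hRH M hM R hR δ hδ hδ2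
  obtain ⟨C₂, hC₂⟩ := AH.exists_abs_integral_heathBrownG_odd_sub_le hRH hM hR hδ hδ2
  have hG0 := (bgstb2025_lemma5_rh_holds hRH).1
  refine ⟨|C| + |C₂|, ?_⟩
  filter_upwards [hC, hC₂, eventually_gt_atTop (1 : ℝ)] with T hT hT₂ hT1 lam mu hlam hlm hmu4
    K hK
  obtain ⟨L, rfl⟩ := hK
  push_cast
  have hmu : 0 < mu := lt_of_lt_of_le hlam hlm
  have hlog : 0 < Real.log T := Real.log_pos hT1
  have hsq : 0 < Real.sqrt (Real.log T) := Real.sqrt_pos.mpr hlog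
  have hRT : 0 < R T := hR.1 T
  -- the inputs
  have h5 := hT mu hmu hmu4
  have htr := hT₂ mu hmu hmu4 L
  have hmaj := AH.sq_sub_mul_integral_window_le hlam hlm hT1 (2 * (L : ℝ) + 1)
  have hX0 : 0 ≤ ∫ α in ((2 * L + 1 : ℝ) - mu)..((2 * L + 1 : ℝ) + mu), AH.heathBrownG mu α T :=
    intervalIntegral.integral_nonneg (by linarith) fun α _ ↦ hG0 mu α T hmu (by linarith) hT1
  -- error bookkeeping
  have hEK : 0 ≤ AH.errG M (R T) T mu (2 * L + 1) := by
    simp only [AH.errG]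
    positivity
  have hE1 : AH.errG M (R T) T mu 1 ≤ AH.errG M (R T) T mu (2 * L + 1) := by
    have hK1 : (1 : ℝ) ≤ |(2 * L + 1 : ℝ)| := by
      have h : (1 : ℤ) ≤ |2 * L + 1| := Int.one_le_abs (by omega)
      have h' := (Int.cast_le (R := ℝ)).mpr h
      push_cast [Int.cast_abs] at h'
      exact h'
    simp only [AH.errG, abs_one]
    have hMR : 0 ≤ M ^ 2 * R T := by positivity
    nlinarith
  have hS : 0 ≤ mu + AH.errG M (R T) T mu 1 + 1 / (mu ^ 2 * Real.sqrt (Real.log T)) := by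
    have : 0 ≤ AH.errG M (R T) T mu 1 := by
      simp only [AH.errG]
      positivity
    positivity
  set B : ℝ := 2 * (AH.binDensity 0 T M δ - 1) +
    (|C| + |C₂|) * (mu + AH.errG M (R T) T mu (2 * L + 1) + 1 / (mu ^ 2 * Real.sqrt (Real.log T)))
    with hB
  -- `X_K ≤ B`
  have h5' : (∫ α in (1 - mu)..(1 + mu), AH.heathBrownG mu α T) ≤ 2 * (AH.binDensity 0 T M δ - 1) +
      |C| * (mu + AH.errG M (R T) T mu 1 + 1 / (mu ^ 2 * Real.sqrt (Real.log T))) := by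
    have := (abs_le.mp (h5.trans (mul_le_mul_of_nonneg_right (le_abs_self C) hS))).2
    linarith
  have htr' : (∫ α in ((2 * L + 1 : ℝ) - mu)..((2 * L + 1 : ℝ) + mu), AH.heathBrownG mu α T) ≤
      (∫ α in (1 - mu)..(1 + mu), AH.heathBrownG mu α T) +
        |C₂| * mu * AH.errG M (R T) T mu (2 * L + 1) := by
    have := (abs_le.mp (htr.trans
      (mul_le_mul_of_nonneg_right (mul_le_mul_of_nonneg_right (le_abs_self C₂) hmu.le) hEK))).2
    linarith
  have hXB : (∫ α in ((2 * L + 1 : ℝ) - mu)..((2 * L + 1 : ℝ) + mu), AH.heathBrownG mu α T) ≤ B := by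
    rw [hB]
    have p1 := mul_le_mul_of_nonneg_left hE1 (abs_nonneg C)
    have p2 : |C₂| * mu * AH.errG M (R T) T mu (2 * L + 1) ≤
        |C₂| * AH.errG M (R T) T mu (2 * L + 1) := by
      have := mul_le_mul_of_nonneg_right hmu4 hEK
      have := mul_le_mul_of_nonneg_left this (abs_nonneg C₂)
      nlinarith [abs_nonneg C₂]
    have p3 : 0 ≤ |C₂| * (mu + 1 / (mu ^ 2 * Real.sqrt (Real.log T))) := by positivity
    nlinarith [p1, p2, p3, h5', htr']
  -- `∫ F ≤ (1 + λ²/μ²) X_K`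
  have hpos : 0 < mu ^ 2 - lam ^ 2 / 2 := by
    have : lam ^ 2 ≤ mu ^ 2 := pow_le_pow_left₀ hlam.le hlm 2
    nlinarith [pow_pos hmu 2]
  have ht : lam ^ 2 / mu ^ 2 ≤ 1 := by
    rw [div_le_one (by positivity)]
    exact pow_le_pow_left₀ hlam.le hlm 2
  have hkey : (mu ^ 2 - lam ^ 2 / 2) *
      ∫ β in ((2 * L + 1 : ℝ) - lam)..((2 * L + 1 : ℝ) + lam), montgomeryFormFactor β T ≤
      (mu ^ 2 - lam ^ 2 / 2) * ((1 + lam ^ 2 / mu ^ 2) *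
        ∫ α in ((2 * L + 1 : ℝ) - mu)..((2 * L + 1 : ℝ) + mu), AH.heathBrownG mu α T) := by
    refine hmaj.trans ?_
    have e : (mu ^ 2 - lam ^ 2 / 2) * ((1 + lam ^ 2 / mu ^ 2) *
        ∫ α in ((2 * L + 1 : ℝ) - mu)..((2 * L + 1 : ℝ) + mu), AH.heathBrownG mu α T) -
        mu ^ 2 * ∫ α in ((2 * L + 1 : ℝ) - mu)..((2 * L + 1 : ℝ) + mu), AH.heathBrownG mu α T =
        lam ^ 2 / 2 * (1 - lam ^ 2 / mu ^ 2) *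
          ∫ α in ((2 * L + 1 : ℝ) - mu)..((2 * L + 1 : ℝ) + mu), AH.heathBrownG mu α T := by
      field_simp
      ring
    have : 0 ≤ lam ^ 2 / 2 * (1 - lam ^ 2 / mu ^ 2) *
        ∫ α in ((2 * L + 1 : ℝ) - mu)..((2 * L + 1 : ℝ) + mu), AH.heathBrownG mu α T :=
      mul_nonneg (mul_nonneg (by positivity) (sub_nonneg.mpr ht)) hX0
    linarith
  have hI := le_of_mul_le_mul_left hkey hpos
  refine hI.trans ?_
  exact mul_le_mul_of_nonneg_left hXB (by positivity)

/-! ## §7. Lemma 6 (ii): the windows at non-integers (proved; printed route) -/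

/-- `s(ξ + 2L) = s(ξ)` for `L ∈ ℤ` (2-periodicity of the sawtooth, iterated).
[cite: LagariasRodgers2020, §2.3 (2.3)] -/
theorem triangleWave_add_two_mul_int (ξ : ℝ) (L : ℤ) :
    triangleWave (ξ + 2 * L) = triangleWave ξ := by
  unfold triangleWave
  rw [show (ξ + 2 * L) / 2 = ξ / 2 + ((L : ℤ) : ℝ) by ring, round_add_intCast]
  push_cast
  ring_nf

/-- Radii `λ − λ² ≤ μ ≤ λ + λ²` with `0 < λ ≤ 1/4` (arithmetic). [folklore] -/
private theorem ii_radius {lam μ : ℝ} (hlam : 0 < lam) (hlam4 : lam ≤ 1 / 4)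
    (hμ1 : lam - lam ^ 2 ≤ μ) (hμ2 : μ ≤ lam + lam ^ 2) :
    0 < μ ∧ μ ≤ 2 * lam ∧ μ ^ 2 ≤ 2 * lam ^ 2 ∧ lam ^ 2 ≤ 2 * μ ^ 2 := by
  have hl2 : lam ^ 2 ≤ lam / 4 := by nlinarith
  have hμ0 : 0 < μ := by nlinarith
  have hμ34 : 3 / 4 * lam ≤ μ := by nlinarith
  refine ⟨hμ0, by nlinarith, by nlinarith, by nlinarith⟩

/-- The error shape of Lemma 6 (ii) after the differencing at `h = λ²` (arithmetic). [folklore] -/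
private theorem ii_err_shape {lam μ s l E A B : ℝ} (hlam : 0 < lam) (hlam4 : lam ≤ 1 / 4)
    (hμ1 : lam - lam ^ 2 ≤ μ) (hμ2 : μ ≤ lam + lam ^ 2) (hs : 1 ≤ s) (hsl : s ≤ l)
    (hE : 0 ≤ E) (hA : 0 ≤ A) (hB : 0 ≤ B) :
    A * (μ ^ 2 / s + 1 / l) + B * μ ^ 2 * (2 * E) ≤
      2 * lam ^ 3 * ((2 * (A + B)) * (lam + 1 / (lam ^ 5 * s) + E / lam)) := by
  obtain ⟨hμ0, -, hμle, -⟩ := ii_radius hlam hlam4 hμ1 hμ2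
  have hs0 : 0 < s := by linarith
  have hl0 : 0 < l := by linarith
  have hl1 : lam ≤ 1 := by linarith
  have hl4 : lam ^ 4 ≤ 1 := pow_le_one₀ hlam.le hl1
  -- `μ²/s ≤ 2/(λ² s)`, `1/l ≤ 1/s ≤ 2/(λ² s)`, `B μ² 2E ≤ 4 B λ² E`
  set X : ℝ := 1 / (lam ^ 2 * s) with hX
  have hX0 : 0 ≤ X := by positivity
  have t1 : μ ^ 2 / s ≤ 2 * X := by
    rw [hX, div_le_iff₀ hs0, show 2 * (1 / (lam ^ 2 * s)) * s = 2 / lam ^ 2 by field_simp,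
      le_div_iff₀ (by positivity)]
    calc μ ^ 2 * lam ^ 2 ≤ 2 * lam ^ 2 * lam ^ 2 := by gcongr
      _ = 2 * lam ^ 4 := by ring
      _ ≤ 2 * 1 := by gcongr
      _ = 2 := by ring
  have t2 : 1 / l ≤ 2 * X := by
    have h1 : 1 / l ≤ 1 / s := one_div_le_one_div_of_le hs0 hsl
    have h2 : 1 / s ≤ 2 * X := by
      rw [hX, show 2 * (1 / (lam ^ 2 * s)) = (2 / lam ^ 2) * (1 / s) by field_simp]
      have : (1 : ℝ) ≤ 2 / lam ^ 2 := by
        rw [le_div_iff₀ (by positivity)]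
        nlinarith
      have hs' : 0 ≤ 1 / s := by positivity
      nlinarith
    linarith
  have t3 : μ ^ 2 * (2 * E) ≤ 4 * (lam ^ 2 * E) := by nlinarith
  have p1 : A * (μ ^ 2 / s + 1 / l) ≤ A * (4 * X) := by
    have := add_le_add t1 t2
    have := mul_le_mul_of_nonneg_left this hA
    linarith
  have p2 : B * μ ^ 2 * (2 * E) ≤ B * (4 * (lam ^ 2 * E)) := by
    rw [mul_assoc]
    exact mul_le_mul_of_nonneg_left t3 hB
  have q1 : 0 ≤ A * lam ^ 4 := by positivity
  have q2 : 0 ≤ A * (lam ^ 2 * E) := by positivity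
  have q3 : 0 ≤ B * lam ^ 4 := by positivity
  have q4 : 0 ≤ B * X := by positivity
  have expand : 2 * lam ^ 3 * ((2 * (A + B)) * (lam + 1 / (lam ^ 5 * s) + E / lam)) =
      4 * (A * lam ^ 4) + 4 * (B * lam ^ 4) + 4 * (A * X) + 4 * (B * X) +
        4 * (A * (lam ^ 2 * E)) + 4 * (B * (lam ^ 2 * E)) := by
    rw [hX]
    field_simp
    ring
  rw [expand]
  have eA : A * (4 * X) = 4 * (A * X) := by ring
  have eB : B * (4 * (lam ^ 2 * E)) = 4 * (B * (lam ^ 2 * E)) := by ring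
  linarith

/-- Final bookkeeping of Lemma 6 (ii) (arithmetic). [folklore] -/
private theorem ii_final {lam t c S : ℝ} (hlam : 0 < lam) (ht : t ≤ 1) (hc : 0 ≤ c)
    (hS : lam ≤ S) :
    lam / 2 * t + 2 * (2 * c * S) ≤ (8 * c + 1) * S := by
  have hS0 : 0 ≤ S := hlam.le.trans hS
  nlinarith

set_option maxHeartbeats 400000 in
/-- **BGSTB 2025, Lemma 6 (ii) — proved from RH** (for every AH-Pairs datum `(M, R)` and bin
half-width `δ`). Printed: "For any fixed `α ∈ ℝ ∖ ℤ`, choose `λ` so that `0 < λ ≤ ½‖α‖`. Then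
(ii) `(1/2λ) ∫_{α−λ}^{α+λ} F(β) dβ = s(α) + O(λ) + O(1/(λ⁵ √log T)) + O((1/λ) E_G(λ, L))`", where
(printed proof, p0014:L69–L100) `2L` is the even integer with `α* := α − 2L`,
"`−1 + 2λ ≤ α* ≤ −2λ` if `[α]` is odd and `2λ ≤ α* ≤ 1 − 2λ` if `[α]` is even". Rendered with that
normalisation as the hypothesis `2λ ≤ |α − 2L| ≤ 1 − 2λ` (so `s(α) = |α − 2L|`), `0 < λ ≤ 1/4`,
one constant for all large `T`, uniformly in `λ, L, α`. Proof as printed: Lemma 5 (iv) [tree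
`AH.heathBrownG_add_two_mul_sub_le`] and (ii) [tree `bgstb2025_lemma5_rh_holds`] give
`H_μ(α) = μ² s(α) + O(μ²/√log T) + O(1/log T) + O(μ² E_G(μ, L))` at `μ ∈ {λ − λ², λ, λ + λ²}`, then
(F-Hthm4) with `h = λ²` (our bookkeeping: `E_G(μ, |α*| + 2|L|) ≤ 2 E_G(λ, L)` for `μ ≥ 3λ/4`; the
resulting `O(1/(λ √log T)) + O(1/(λ³ log T))` is weakened to the printed `O(1/(λ⁵ √log T))`).
Unaffected by E-ah-5. [cite: BaluyotGoldstonSuriajayaTurnageButterbaugh2025, Lemma 6 (ii)] -/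
theorem bgstb2025_lemma6_ii (hRH : RiemannHypothesis) :
    ∀ M : ℝ, 0 < M → ∀ R : ℝ → ℝ, AH.IsPairsRate M R → ∀ δ : ℝ, 0 < δ → δ ≤ 1 / 2 →
      ∃ C : ℝ, ∀ᶠ T : ℝ in atTop, ∀ lam : ℝ, 0 < lam → lam ≤ 1 / 4 → ∀ L : ℤ, ∀ α : ℝ,
        2 * lam ≤ |α - 2 * L| → |α - 2 * L| ≤ 1 - 2 * lam →
          |1 / (2 * lam) * (∫ β in (α - lam)..(α + lam), montgomeryFormFactor β T) -
              triangleWave α| ≤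
            C * (lam + 1 / (lam ^ 5 * Real.sqrt (Real.log T)) + AH.errG M (R T) T lam L / lam) := by
  intro M hM R hR δ hδ hδ2
  obtain ⟨C₁, h₁⟩ := (bgstb2025_lemma5_rh_holds hRH).2
  obtain ⟨C₂, h₂⟩ := AH.heathBrownG_add_two_mul_sub_le hRH hM hR hδ hδ2
  have hR0 : ∀ T, 0 < R T := hR.1
  refine ⟨8 * (|C₁| + |C₂|) + 1, ?_⟩
  filter_upwards [h₁, h₂, eventually_gt_atTop (1 : ℝ),
    Real.tendsto_log_atTop.eventually (eventually_ge_atTop (1 : ℝ))] with T hT₁ hT₂ hT1 hlogT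
    lam hlam hlam4 L α hαlo hαhi
  have hlog0 : 0 < Real.log T := by linarith
  have hsq1 : 1 ≤ Real.sqrt (Real.log T) := by
    rw [show (1 : ℝ) = Real.sqrt 1 by simp]
    exact Real.sqrt_le_sqrt hlogT
  have hsq0 : 0 < Real.sqrt (Real.log T) := by linarith
  have hsqle : Real.sqrt (Real.log T) ≤ Real.log T := by
    have h := Real.sq_sqrt hlog0.le
    nlinarith
  have hRT : 0 ≤ R T := (hR0 T).le
  have hl1 : lam ≤ 1 := by linarith
  -- `α* = α − 2L`, `s(α) = |α*|`
  set a : ℝ := α - 2 * L with ha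
  have hs : triangleWave α = |a| := by
    have : α = a + 2 * L := by rw [ha]; ring
    rw [this, triangleWave_add_two_mul_int, triangleWave_of_abs_le_one (by linarith)]
  rw [hs]
  have ha1 : |a| ≤ 1 := by linarith
  set E : ℝ := AH.errG M (R T) T lam L with hE
  have hE0 : 0 ≤ E := by
    simp only [hE, AH.errG]
    positivity
  set H : ℝ → ℝ := fun μ ↦ μ ^ 2 * AH.heathBrownG μ α T with hH
  -- `|H μ − μ² |a|| ≤ Δ(μ)` for `λ − λ² ≤ μ ≤ λ + λ²`
  have hΔ : ∀ μ : ℝ, lam - lam ^ 2 ≤ μ → μ ≤ lam + lam ^ 2 →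
      abs (H μ - μ ^ 2 * |a|) ≤
        |C₁| * (μ ^ 2 / Real.sqrt (Real.log T) + 1 / Real.log T) + |C₂| * μ ^ 2 * (2 * E) := by
    intro μ hμ1 hμ2
    obtain ⟨hμ0, hμ2l, -, hl2μ⟩ := ii_radius hlam hlam4 hμ1 hμ2
    have hμ12 : μ ≤ 1 / 2 := by linarith
    have hμa : μ ≤ |a| := by linarith
    have hμa' : |a| ≤ 1 - μ := by linarith
    -- Lemma 5 (ii) at `a`, radius `μ`
    have hii := (hT₁ μ hμ0 hμ12 a).2 hμa hμa'
    -- Lemma 5 (iv): `G_μ(a + 2L) = G_μ(a) + O(E_G(μ, |a| + 2|L|))`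
    have hiv := hT₂ μ hμ0 hμ12 a L
    have hαa : a + 2 * L = α := by rw [ha]; ring
    rw [hαa] at hiv
    -- `E_G(μ, |a| + 2|L|) ≤ 2 E`
    have hEμ : AH.errG M (R T) T μ (|a| + 2 * |(L : ℝ)|) ≤ 2 * E := by
      simp only [hE, AH.errG]
      rw [abs_of_nonneg (by positivity : (0 : ℝ) ≤ |a| + 2 * |(L : ℝ)|)]
      have h1 : 1 / (μ ^ 2 * M) ≤ 2 * (1 / (lam ^ 2 * M)) := by
        rw [div_le_iff₀ (by positivity), show 2 * (1 / (lam ^ 2 * M)) * (μ ^ 2 * M) =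
          2 * μ ^ 2 / lam ^ 2 by field_simp]
        rw [le_div_iff₀ (by positivity), one_mul]
        exact hl2μ
      have h2 : (|a| + 2 * |(L : ℝ)| + 1) * M ^ 2 * R T ≤ 2 * ((|(L : ℝ)| + 1) * M ^ 2 * R T) := by
        have hMR : 0 ≤ M ^ 2 * R T := by positivity
        have hcoef : |a| + 2 * |(L : ℝ)| + 1 ≤ 2 * (|(L : ℝ)| + 1) := by linarith
        have := mul_le_mul_of_nonneg_right hcoef hMR
        linarith
      have h3 : 1 / Real.log T ≤ 2 * (1 / Real.log T) := by
        have : 0 ≤ 1 / Real.log T := by positivity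
        linarith
      linarith
    have hC₁ : C₁ * (1 / Real.sqrt (Real.log T) + 1 / (μ ^ 2 * Real.log T)) ≤
        |C₁| * (1 / Real.sqrt (Real.log T) + 1 / (μ ^ 2 * Real.log T)) :=
      mul_le_mul_of_nonneg_right (le_abs_self _) (by positivity)
    have hC₂ : C₂ * AH.errG M (R T) T μ (|a| + 2 * |(L : ℝ)|) ≤ |C₂| * (2 * E) := by
      calc C₂ * AH.errG M (R T) T μ (|a| + 2 * |(L : ℝ)|)
          ≤ |C₂| * AH.errG M (R T) T μ (|a| + 2 * |(L : ℝ)|) :=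
            mul_le_mul_of_nonneg_right (le_abs_self _) (by simp only [AH.errG]; positivity)
        _ ≤ |C₂| * (2 * E) := mul_le_mul_of_nonneg_left hEμ (abs_nonneg _)
    have hGa : abs (AH.heathBrownG μ a T - |a|) ≤
        |C₁| * (1 / Real.sqrt (Real.log T) + 1 / (μ ^ 2 * Real.log T)) := hii.trans hC₁
    have hGb : |AH.heathBrownG μ α T - AH.heathBrownG μ a T| ≤ |C₂| * (2 * E) := hiv.trans hC₂
    have hsplit : H μ - μ ^ 2 * |a| = μ ^ 2 * (AH.heathBrownG μ α T - AH.heathBrownG μ a T) +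
        μ ^ 2 * (AH.heathBrownG μ a T - |a|) := by
      simp only [hH]
      ring
    rw [hsplit]
    calc |μ ^ 2 * (AH.heathBrownG μ α T - AH.heathBrownG μ a T) +
          μ ^ 2 * (AH.heathBrownG μ a T - |a|)|
        ≤ μ ^ 2 * |AH.heathBrownG μ α T - AH.heathBrownG μ a T| +
          μ ^ 2 * abs (AH.heathBrownG μ a T - |a|) := by
          refine (abs_add_le _ _).trans ?_
          rw [abs_mul, abs_mul, abs_of_nonneg (sq_nonneg μ)]
      _ ≤ μ ^ 2 * (|C₂| * (2 * E)) +
          μ ^ 2 * (|C₁| * (1 / Real.sqrt (Real.log T) + 1 / (μ ^ 2 * Real.log T))) := by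
          gcongr
      _ = |C₁| * (μ ^ 2 / Real.sqrt (Real.log T) + 1 / Real.log T) + |C₂| * μ ^ 2 * (2 * E) := by
          field_simp
          ring
  -- each `Δ(μ)` is `≤ 2λ³ A`, `A = 2(|C₁| + |C₂|)(λ + 1/(λ⁵ √log T) + E/λ)`
  set A : ℝ := (2 * (|C₁| + |C₂|)) *
    (lam + 1 / (lam ^ 5 * Real.sqrt (Real.log T)) + E / lam) with hAdef
  have hΔ' : ∀ μ : ℝ, lam - lam ^ 2 ≤ μ → μ ≤ lam + lam ^ 2 →
      abs (H μ - μ ^ 2 * |a|) ≤ 2 * lam ^ 3 * A := fun μ hμ1 hμ2 ↦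
    (hΔ μ hμ1 hμ2).trans (ii_err_shape hlam hlam4 hμ1 hμ2 hsq1 hsqle hE0 (abs_nonneg C₁)
      (abs_nonneg C₂))
  -- the differencing at `h = λ²`
  set I : ℝ := ∫ β in (-lam)..lam, montgomeryFormFactor (α + β) T with hI
  have hh : 0 < lam ^ 2 := by positivity
  have hhl : lam ^ 2 < lam := by nlinarith
  have hup := AH.integral_window_add_le hT1 hlam hh α
  have hlow := AH.integral_window_sub_le hT1 hh hhl α
  have hHlam : H lam = ∫ β in (-lam)..lam, (lam - |β|) * montgomeryFormFactor (α + β) T := by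
    simp only [hH]
    exact AH.sq_mul_heathBrownG hlam.ne' _ _
  have hHup : H (lam + lam ^ 2) =
      ∫ β in (-(lam + lam ^ 2))..(lam + lam ^ 2),
        (lam + lam ^ 2 - |β|) * montgomeryFormFactor (α + β) T := by
    simp only [hH]
    exact AH.sq_mul_heathBrownG (by positivity) _ _
  have hHlow : H (lam - lam ^ 2) =
      ∫ β in (-(lam - lam ^ 2))..(lam - lam ^ 2),
        (lam - lam ^ 2 - |β|) * montgomeryFormFactor (α + β) T := by
    simp only [hH]
    exact AH.sq_mul_heathBrownG (by linarith) _ _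
  rw [← hHlam, ← hHup] at hup
  rw [← hHlam, ← hHlow] at hlow
  -- `hup : λ² I + H λ ≤ H(λ + λ²)`, `hlow : H λ − λ² I ≤ H(λ − λ²)`
  have hb1 := hΔ' lam (by nlinarith) (by nlinarith)
  have hb2 := hΔ' (lam + lam ^ 2) (by nlinarith) le_rfl
  have hb3 := hΔ' (lam - lam ^ 2) le_rfl (by nlinarith)
  have hI1 : 1 / (2 * lam) * I - |a| ≤ lam / 2 * |a| + 2 * A := by
    have h1 := (abs_le.mp hb2).2
    have h2 := (abs_le.mp hb1).1
    have key : lam ^ 2 * I ≤ lam ^ 2 * ((2 * lam + lam ^ 2) * |a| + 4 * lam * A) := by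
      linarith
    have := le_of_mul_le_mul_left key hh
    rw [show 1 / (2 * lam) * I - |a| = (I - 2 * lam * |a|) / (2 * lam) by field_simp,
      div_le_iff₀ (by linarith)]
    linarith
  have hI2 : -(lam / 2 * |a| + 2 * A) ≤ 1 / (2 * lam) * I - |a| := by
    have h1 := (abs_le.mp hb1).1
    have h2 := (abs_le.mp hb3).2
    have key : lam ^ 2 * ((2 * lam - lam ^ 2) * |a| - 4 * lam * A) ≤ lam ^ 2 * I := by
      linarith
    have := le_of_mul_le_mul_left key hh
    rw [show 1 / (2 * lam) * I - |a| = (I - 2 * lam * |a|) / (2 * lam) by field_simp,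
      le_div_iff₀ (by linarith)]
    linarith
  -- rewrite the window integral and conclude
  have hIeq : (∫ β in (α - lam)..(α + lam), montgomeryFormFactor β T) = I := by
    rw [hI, intervalIntegral.integral_comp_add_left (fun β ↦ montgomeryFormFactor β T) α,
      sub_eq_add_neg]
  rw [hIeq]
  have hfin : abs (1 / (2 * lam) * I - |a|) ≤ lam / 2 * |a| + 2 * A := abs_le.mpr ⟨hI2, hI1⟩
  refine hfin.trans ?_
  rw [hAdef]
  have hS : lam ≤ lam + 1 / (lam ^ 5 * Real.sqrt (Real.log T)) + E / lam := by
    have : 0 ≤ 1 / (lam ^ 5 * Real.sqrt (Real.log T)) + E / lam := by positivity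
    linarith
  exact ii_final hlam ha1 (add_nonneg (abs_nonneg C₁) (abs_nonneg C₂)) hS

/-! ## §8. The one-sided windows at `±1` (what (K=1iii)+(iv) were printed to give) -/

/-- **The one-sided window at `1`, LOWER half — proved from RH.** OURS (sound replacement of the
printed l.26 conclusion "`∫_1^{1+λ} F(w) dw = 2(P_0 − 1) + O(λ) + O(E_G(λ,1)) + O(1/(λ² √log T))`",
p0015:L26, which inherits E-ah-5): for all large `T` and `0 < λ ≤ 1/4`,
`2(P_0 − 1) − C(λ + E_G(λ/2, 1) + 1/(λ² √log T)) ≤ ∫_1^{1+λ} F(β, T) dβ`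
(`bgstb2025_lemma6_iii_lower_odd` at `K = 1` and `bgstb2025_lemma6_iv`).
[cite: BaluyotGoldstonSuriajayaTurnageButterbaugh2025, §6, proof of Lemma 6 (iii)–(v)] -/
theorem bgstb2025_lemma6_right_of_one_lower (hRH : RiemannHypothesis) :
    ∀ M : ℝ, 0 < M → ∀ R : ℝ → ℝ, AH.IsPairsRate M R → ∀ δ : ℝ, 0 < δ → δ ≤ 1 / 2 →
      ∃ C : ℝ, ∀ᶠ T : ℝ in atTop, ∀ lam : ℝ, 0 < lam → lam ≤ 1 / 4 →
        2 * (AH.binDensity 0 T M δ - 1) -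
            C * (lam + AH.errG M (R T) T (lam / 2) 1 + 1 / (lam ^ 2 * Real.sqrt (Real.log T))) ≤
          ∫ β in (1 : ℝ)..(1 + lam), montgomeryFormFactor β T := by
  intro M hM R hR δ hδ hδ2
  obtain ⟨C, hC⟩ := bgstb2025_lemma6_iii_lower_odd hRH M hM R hR δ hδ hδ2
  obtain ⟨C₄, hC₄⟩ := bgstb2025_lemma6_iv hRH
  refine ⟨|C| + |C₄|, ?_⟩
  filter_upwards [hC, hC₄, eventually_gt_atTop (1 : ℝ)] with T hT hT₄ hT1 lam hlam hlam4
  have hlog : 0 < Real.log T := Real.log_pos hT1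
  have hRT : 0 < R T := hR.1 T
  have h1 := hT lam hlam (by linarith) 1 (by decide)
  push_cast at h1
  have h4 := (hT₄ lam hlam hlam4).1
  set S : ℝ := lam + AH.errG M (R T) T (lam / 2) 1 + 1 / (lam ^ 2 * Real.sqrt (Real.log T))
    with hS
  have hE : 0 ≤ AH.errG M (R T) T (lam / 2) 1 := by
    simp only [AH.errG]
    positivity
  have hS0 : lam ≤ S := by
    have : 0 ≤ 1 / (lam ^ 2 * Real.sqrt (Real.log T)) := by positivity
    rw [hS]
    linarith
  have hSnn : 0 ≤ S := hlam.le.trans hS0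
  have p1 : C * S ≤ |C| * S := mul_le_mul_of_nonneg_right (le_abs_self C) hSnn
  have p2 : C₄ * lam ≤ |C₄| * S :=
    (mul_le_mul_of_nonneg_right (le_abs_self C₄) hlam.le).trans
      (mul_le_mul_of_nonneg_left hS0 (abs_nonneg C₄))
  have h4' := (abs_le.mp h4).2
  nlinarith [h1, h4', p1, p2]

/-- **The one-sided window at `1`, UPPER half — proved from RH.** OURS (sound replacement, E-ah-5):
for all large `T`, `0 < λ ≤ μ ≤ 1/4`,
`∫_1^{1+λ} F(β, T) dβ ≤ (1 + λ²/μ²)(2(P_0 − 1) + C(μ + E_G(μ, 1) + 1/(μ² √log T)))`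
(`F ≥ 0` drops `∫_{1−λ}^{1} F`; then `bgstb2025_lemma6_iii_upper_odd` at `K = 1`).
[cite: BaluyotGoldstonSuriajayaTurnageButterbaugh2025, §6, proof of Lemma 6 (iii)–(v)] -/
theorem bgstb2025_lemma6_right_of_one_upper (hRH : RiemannHypothesis) :
    ∀ M : ℝ, 0 < M → ∀ R : ℝ → ℝ, AH.IsPairsRate M R → ∀ δ : ℝ, 0 < δ → δ ≤ 1 / 2 →
      ∃ C : ℝ, ∀ᶠ T : ℝ in atTop, ∀ lam mu : ℝ, 0 < lam → lam ≤ mu → mu ≤ 1 / 4 →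
        ∫ β in (1 : ℝ)..(1 + lam), montgomeryFormFactor β T ≤
          (1 + lam ^ 2 / mu ^ 2) * (2 * (AH.binDensity 0 T M δ - 1) +
            C * (mu + AH.errG M (R T) T mu 1 + 1 / (mu ^ 2 * Real.sqrt (Real.log T)))) := by
  intro M hM R hR δ hδ hδ2
  obtain ⟨C, hC⟩ := bgstb2025_lemma6_iii_upper_odd hRH M hM R hR δ hδ hδ2
  refine ⟨C, ?_⟩
  filter_upwards [hC, eventually_gt_atTop (1 : ℝ)] with T hT hT1 lam mu hlam hlm hmu4
  have h1 := hT lam mu hlam hlm hmu4 1 (by decide)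
  push_cast at h1
  have hFc : Continuous fun β ↦ montgomeryFormFactor β T :=
    RudnickSarnak.continuous_montgomeryFormFactor T
  have hsplit := intervalIntegral.integral_add_adjacent_intervals
    (hFc.intervalIntegrable (μ := volume) (1 - lam) 1)
    (hFc.intervalIntegrable (μ := volume) 1 (1 + lam))
  have hleft : 0 ≤ ∫ β in (1 - lam)..(1 : ℝ), montgomeryFormFactor β T :=
    intervalIntegral.integral_nonneg (by linarith) fun β _ ↦
      Montgomery.montgomeryFormFactor_nonneg β hT1
  linarith

/-- **The one-sided windows at `−1`** (by evenness `F(−α) = F(α)`):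
`∫_{−1−λ}^{−1} F = ∫_1^{1+λ} F`, so the two bounds above transfer verbatim.
[cite: BaluyotGoldstonSuriajayaTurnageButterbaugh2025, §6, proof of Lemma 6 (iii)–(v)] -/
theorem integral_formFactor_left_of_neg_one_eq (lam T : ℝ) :
    ∫ β in (-1 - lam)..(-1 : ℝ), montgomeryFormFactor β T =
      ∫ β in (1 : ℝ)..(1 + lam), montgomeryFormFactor β T := by
  rw [← Montgomery.integral_formFactor_comp_neg 1 (1 + lam) T, neg_add', sub_eq_add_neg]

/-! ## §9. Lemma 6 (ii), uniform form (the `L`-bookkeeping discharged) -/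

/-- **Lemma 6 (ii), uniform form** (OUR repackaging of `bgstb2025_lemma6_ii` for use on
integer-free intervals): for all large `T`, all `0 < λ ≤ 1/4` and every `α` at distance `≥ 2λ`
from `ℤ` ("choose `λ` so that `0 < λ ≤ ½‖α‖`"),
`|(1/2λ) ∫_{α−λ}^{α+λ} F − s(α)| ≤ C(λ + 1/(λ⁵ √log T) + E_G(λ, |α| + 1)/λ)`; here `2L` is chosen
as `2·round(α/2)` (so `2λ ≤ |α − 2L| ≤ 1 − 2λ`) and `E_G(λ, L) ≤ E_G(λ, |α| + 1)` absorbs it.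
[cite: BaluyotGoldstonSuriajayaTurnageButterbaugh2025, Lemma 6 (ii)] -/
theorem bgstb2025_lemma6_ii_uniform (hRH : RiemannHypothesis) :
    ∀ M : ℝ, 0 < M → ∀ R : ℝ → ℝ, AH.IsPairsRate M R → ∀ δ : ℝ, 0 < δ → δ ≤ 1 / 2 →
      ∃ C : ℝ, ∀ᶠ T : ℝ in atTop, ∀ lam : ℝ, 0 < lam → lam ≤ 1 / 4 → ∀ α : ℝ,
        (∀ n : ℤ, 2 * lam ≤ |α - n|) →
          |1 / (2 * lam) * (∫ β in (α - lam)..(α + lam), montgomeryFormFactor β T) -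
              triangleWave α| ≤
            C * (lam + 1 / (lam ^ 5 * Real.sqrt (Real.log T)) +
              AH.errG M (R T) T lam (|α| + 1) / lam) := by
  intro M hM R hR δ hδ hδ2
  obtain ⟨C, hC⟩ := bgstb2025_lemma6_ii hRH M hM R hR δ hδ hδ2
  refine ⟨|C|, ?_⟩
  filter_upwards [hC, eventually_gt_atTop (1 : ℝ)] with T hT hT1 lam hlam hlam4 α hα
  have hlog : 0 < Real.log T := Real.log_pos hT1
  have hRT : 0 < R T := hR.1 T
  -- `2L := 2 round(α/2)`
  set L : ℤ := round (α / 2) with hL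
  have hr : |α / 2 - L| ≤ 1 / 2 := abs_sub_round (α / 2)
  have ha1 : |α - 2 * L| ≤ 1 := by
    rw [show α - 2 * (L : ℝ) = 2 * (α / 2 - L) by ring, abs_mul, abs_two]
    linarith
  have hlo : 2 * lam ≤ |α - 2 * L| := by
    have := hα (2 * L)
    push_cast at this
    exact this
  have hhi : |α - 2 * L| ≤ 1 - 2 * lam := by
    rcases le_or_gt 0 (α - 2 * L) with h0 | h0
    · have h1 := hα (2 * L + 1)
      push_cast at h1
      rw [show α - (2 * (L : ℝ) + 1) = (α - 2 * L) - 1 by ring] at h1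
      rw [abs_of_nonneg h0] at ha1 ⊢
      rw [abs_of_nonpos (by linarith)] at h1
      linarith
    · have h1 := hα (2 * L - 1)
      push_cast at h1
      rw [show α - (2 * (L : ℝ) - 1) = (α - 2 * L) + 1 by ring] at h1
      rw [abs_of_neg h0] at ha1 ⊢
      rw [abs_of_nonneg (by linarith)] at h1
      linarith
  have h := hT lam hlam hlam4 L α hlo hhi
  -- `E_G(λ, L) ≤ E_G(λ, |α| + 1)` and `C ≤ |C|`
  have hEL : AH.errG M (R T) T lam L ≤ AH.errG M (R T) T lam (|α| + 1) := by
    simp only [AH.errG]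
    have hL1 : |(L : ℝ)| ≤ |α| + 1 := by
      have : |(L : ℝ)| ≤ |α / 2| + 1 / 2 := by
        have := abs_sub_abs_le_abs_sub (L : ℝ) (α / 2)
        rw [abs_sub_comm] at this
        linarith
      rw [abs_div, abs_two] at this
      linarith [abs_nonneg α]
    have hMR : 0 ≤ M ^ 2 * R T := by positivity
    have : |(L : ℝ)| + 1 ≤ |(|α| + 1 : ℝ)| + 1 := by
      rw [abs_of_nonneg (by positivity : (0 : ℝ) ≤ |α| + 1)]
      linarith
    nlinarith
  have hS0 : 0 ≤ lam + 1 / (lam ^ 5 * Real.sqrt (Real.log T)) + AH.errG M (R T) T lam L / lam := by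
    have : 0 ≤ AH.errG M (R T) T lam L := by
      simp only [AH.errG]
      positivity
    positivity
  calc |1 / (2 * lam) * (∫ β in (α - lam)..(α + lam), montgomeryFormFactor β T) - triangleWave α|
      ≤ C * (lam + 1 / (lam ^ 5 * Real.sqrt (Real.log T)) + AH.errG M (R T) T lam L / lam) := h
    _ ≤ |C| * (lam + 1 / (lam ^ 5 * Real.sqrt (Real.log T)) + AH.errG M (R T) T lam L / lam) :=
        mul_le_mul_of_nonneg_right (le_abs_self C) hS0
    _ ≤ |C| * (lam + 1 / (lam ^ 5 * Real.sqrt (Real.log T)) +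
          AH.errG M (R T) T lam (|α| + 1) / lam) := by
        gcongr

end Literature.NumberTheory.LFunctions

end
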